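import Summits.QuantumFields.YangMills.Theses.ParabolicTrajectory
import Literature.MathematicalPhysics.QuantumLattice.GaugeGroupsProofs
import Literature.MathematicalPhysics.QuantumFieldTheory.LatticeGaugeProofs

/-!
# Disproof of `LatticeGapOnTrajectory` — standing adversary work file (cdisprove, gen 3, v4.3)

Crux item `stmt-QuantumFields-10523` = `Summit.QuantumFields.YangMills.Theses.ParabolicTrajectory.LatticeGapOnTrajectory`,
conjunct (B) of route `ParabolicTrajectory` (rev 4): for every compact simple `G`, faithful unitary `r`, `M`, `θ > 0`
and every `M`-adic Wilson scheme `sch` (`a_k = M^{-n_k}`) with `β_k → ∞` whose dimensionless curvature two-point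
function at physical time-separation `1` converges to `θ`, there is `Δ > 0` with `HasLatticeMassGap r sch Δ`
(lattice half) and `T.HasMassGap Δ` for every OS datum `T` that is a continuum limit along `sch` up to species
renormalisations (transfer half).

## Findings (v4.1 = v3.7 + §8 TARGETS on the registered skeleton `dissipative-bridge`, incl. PROOFS of stubs 1 and 3; everything below is checked, sorry-free)

LANDED in the tree (prover-importable, `--supports stmt-QuantumFields-10523`, namespace
`Summit.QuantumFields.YangMills.Theorems.LatticeGapOnTrajectory.Negative`):
* `Theorems/LatticeGapOnTrajectory/Negative/ZeroCoupling.lean` — p69462, commit a8672e74e901 (§1 shape lemmas + §4b);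
* `Theorems/LatticeGapOnTrajectory/Negative/ZeroCouplingGap.lean` — p69843, commit 2ae586034c3b (§4c);
* `Theorems/LatticeGapOnTrajectory/Negative/BlowUp.lean` — p70137, commit ed78c82d662f (`exists_renorm_not_isYangMillsFor`);
* `Theorems/LatticeGapOnTrajectory/Negative/JunkCharts.lean` — p74019, commit 82766f570e63 (gen 3: §8.2/8.3 `DB.junkStep`,
  trivial-group lemmas, `DB.uvPassage_false_without_drift/_absorption`);
* `Theorems/LatticeGapOnTrajectory/Negative/StubUVPassage.lean` — p74478, commit a843897b19b7 (gen 3: §8.4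
  `Stubs.uvPassage_holds` = skeleton stub 1 PROVED, with the one-step lemmas `Stubs.step_*`);
* `Theorems/LatticeGapOnTrajectory/Negative/StubAnchoring.lean` — p74657, commit 131f7ab80562 (gen 3: §8.4
  `Stubs.scaleAnchoring_holds` = skeleton stub 3 PROVED; `Stubs.BridgeChart` copy);
* `Theorems/LatticeGapOnTrajectory/Negative/IdleCertificate.lean` — p74900, commit 718021e9571c (gen 3: §8.1
  `Stubs.bridgeBody_of_rcc`, `Stubs.bridgeChartExists_of_rcc`; §8.2 `Stubs.trivialStep`, `Stubs.bridgeBody_of_subsingleton`,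
  `Stubs.uniformLatticeGap_of_subsingleton`).
GEN 3 (2026-08-16, skeleton `Lines/dissipative-bridge.lean` registered with stubs `stub_uvPassage`, `stub_bridgeChart`,
`stub_anchoring`, `stub_transfer`): new §8 TARGETS — (i) `DB.bridgeBody_of_rcc`: the Zgliczyński–Mischaikow certificate
inside `BridgeChartExists` is formally idle (body ⇐ chart + `UVBound` + `RunningCouplingClustering`, junk extension
`F = S.F`, `H = {g > γ/2}`, `P = id`, `J = 0`), so AS TYPED stub 2 = (∃ Bałaban chart with UV pin) ∧ (IR lattice gap in
running-coupling form) — the line card's "why easier: finite-time, decidable" is not in the type; (ii) `DB.trivialStep`,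
`DB.junkStep`: explicit inhabitants of `BalabanBanachStep G r M` at the trivial group (the `∀ G` stubs range over a
non-empty class without stmt-9684; `DB.bridgeBody_of_subsingleton`: stub 2's fields are jointly satisfiable);
(iii) tightness of stub 1: `DB.uvPassage_false_without_drift` (attracting fixed circle `g = √b` below the tube) and
`DB.uvPassage_false_without_absorption` (window `[γ, γ⁺]` crossed with unabsorbed fibre); (iv) `DB.uvPassage_holds`,
`DB.scaleAnchoring_holds`: stubs 1 and 3 PROVED (sorry-free, std axioms; candidate proofs for the lead, evidence
StubProofs.lean); stub 4 is not junk-refutable (density), no loophole in the thermal/volume bookkeeping.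
HANDOFF (next regimes to try): for the CRUX none promising (a formal `WithoutTuning` kill would need `ξ(β) → ∞` plus an
upper bound on the lattice mass — out of reach; the only live paper threat to the ROUTE (not to (B)) is operator MIXING,
Jaffe–Witten fn. 1); for the LINE: the physics bets L1 (Gibbsianness of blocked SU(N) measures through the crossover;
no theorem either way in print — van Enter–Fernández–Sokal's pathologies are proved for spin systems near first-order lines)
and L2 (tail damping at g ≈ 1) of stub 2; the one documented failure of a weak-to-strong "bridge" is Tomboulis's
MK-decimation sandwich (arXiv:0707.2179): Ito–Seiler arXiv:0711.4930 §3 (read at page level this cycle) locate the gap at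
the interpolation inequality `A(α) > A⁺(α)` ((5.15) there) — "It is not clear where and how his claim is proven for large
β where the high-temperature expansion never works!" — and §2 note that any group-blind version would confine `U(1)₄`
(tree barrier `MigdalKadanoffGroupBlindness`); the line's `transport`/`RunningCouplingClustering` is exactly the
statement such an interpolation would have to deliver, now isolated as the content of stub 2 (§8.1).
SECOND LINE (`Lines/trajectory-gap-scaling.lean`, not registered): same verdicts by inspection — `TubeVisited`,
`GapScaling` (via `expect_iterate` + `expect_wilson` + bilinearity in `c`), `ScaleIdentification` provable from the
fields; `SpectralTransfer` lacks `β_k → ∞` but the `β ≡ 0` junk (`hasLatticeMassGap_of_zero_coupling`) only yields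
ultralocal continuum limits, which have every gap on `⁰𝒮` — no kill; `FineScaleTransfer` at `M' = 1` is a
Schwartz-smeared ⇒ pointwise clustering transfer at fixed lattice scale (positivity), plausible; `ArcCertificate` carries
the content and its body is junk-inhabited at the trivial group like `BridgeBody`.

VERDICT: **RESISTS**. No refutation and no misstatement found; (B) is the lattice shadow of the Clay mass gap
(tree: `Literature.MathematicalPhysics.QuantumFieldTheory.LatticeMassGapAllCouplings`, `@[conjecture]`,
Chatterjee arXiv:1803.01950 Problem 5.1) restricted to asymptotically-free tuned sequences, plus a transfer clause
that is sound by spectral semicontinuity (see §4 docstrings).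

* §0 `crux_iff` — the crux uncurried into `Hyps → Concl` (definitional).
* §1 SHAPE (proved): `two_le_of_shape` — the hypothesis `2 ≤ M` is REDUNDANT (implied by `a_k = M^{-n_k}`,
  `a_k > 0`, `a_k → 0`); `tendsto_natPow_of_shape` (`M^{n_k} → ∞`: the tuned separation runs off to infinity in
  lattice units); `eventually_sep_le_L` (`M^{n_k} ≤ L_k` eventually: the tuning is an honest, wrap-around-free
  two-point function at physical distance `1`). No degenerate instance `M ∈ {0,1}` / bounded `n` exists.
* §2 LOGICAL ANATOMY (proved): `hasLatticeMassGap_anti`, `osData_hasMassGap_anti` (both halves antitone in `Δ`),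
  `concl_iff_split` ((B)'s conclusion ⇔ lattice half ∧ transfer half with INDEPENDENT rates — a prover may close
  them separately; a disprover must kill one of them for EVERY `Δ > 0`).
* §3 DISPROOF BURDEN (proved): `tunedWitnessExists_of_not_crux` — any proof of `¬ LatticeGapOnTrajectory` yields
  `TunedWitnessExists` (a compact simple `G` and an `M`-adic Wilson scheme with `β_k → ∞` tuned to some `θ > 0`),
  which is the `∃`-core of the route's conjunct (S) (`tunedWitnessExists_of_tunedSequenceExists`, proved via
  `SU(2)`), rated OPEN by every grounder/refuter (quantitative `ξ(β) → ∞`, Chatterjee Pb 5.1). Conversely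
  `crux_of_not_tunedWitnessExists`: in a world without tuned AF sequences (B) holds vacuously. So
  `¬(B)` is at least as hard as the open lower-bound half of (S), BEFORE any gaplessness is shown.
* §4 JUNK AUDIT (proved): `latticeConnectedCorr_eq_zero_of_subsingleton` + `not_hyps_of_subsingleton` — for a
  trivial gauge group every lattice correlation vanishes, so the tuning hypothesis (θ > 0) is unsatisfiable: dropping
  `IsCompactSimpleLieGroup` does NOT open a junk refutation (the Z⁻¹-normalised Wilson measure has total mass 0 or 1,
  `wilsonMeasure_real_univ`); `transferHalf_inhabited` — for every `(a, β, L)` the transfer fibre at `c = m = 0`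
  contains the vacuum-only theory, which has every gap: the `∀ sch' T` clause is non-vacuous and not junk-refutable
  (species renormalisations are witness data); `exists_renorm_not_isYangMillsFor` (re-proved at gen 2: the blow-up
  renormalisation `c = k·a_k⁻⁴`, `m = 0` makes the degree-one function of the constant observable against a bump
  `≥ k`, so its fibre is EMPTY — `(c, m)` can trivialise or empty a fibre, never manufacture a gapless limit);
  `schwinger_eq_of_isYangMillsFor` (fibre agreement on constrained tensors).
* §4b ZERO COUPLING, FORMAL (proved; new at gen 2): `wilsonMeasure_zero_coupling` (at `β = 0` the Wilson measure
  IS product Haar), `integral_mul_eq_of_dependsOn_disjoint` (ultralocality of a product probability measure via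
  Mathlib independence: functions of disjoint coordinate sets are uncorrelated), `latticeConnectedCorr_zero_coupling`
  (connected torus correlations of local gauge observables vanish EXACTLY at `β = 0` once the torus projections of
  the supports are disjoint), `disjoint_curvature_torusSupports` (the six origin plaquettes vs. their translate by
  `n e₀`, `2 ≤ n ≤ S − 2`: a `ZMod S` computation), `curvatureCorr_zero_coupling_eventually` (for EVERY `M`-adic
  scheme, `⟨P ; τ_{M^{n_k}} P⟩_{β=0} = 0` eventually — the left IVT endpoint `N₁(k, 0) = 0` the (S)-provers need)
  and `not_tuning_of_eventually_zero_coupling` (a scheme with `β_k = 0` eventually cannot be tuned to `θ ≠ 0`: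
  the rev-3 statement `WithoutBeta` is NOT junk-refutable at `β ≡ 0`; every satisfiable instance of the tuning
  is genuinely interacting).
* §4c ZERO COUPLING, LATTICE HALF (proved; new at gen 2): `disjoint_torusSupports_of_time_bound` (general supports
  of time-extent `R`: no shared torus link for `2R < n`, `n + 2R < S`), `hasLatticeMassGap_of_zero_coupling` (for a
  scheme with `β ≡ 0`, `HasLatticeMassGap r sch Δ` holds for EVERY `Δ` — infinite gap; the tree docstring's claim,
  now a theorem), `gap_clauses_junk_reachable` (zero scheme + vacuum satisfy `IsYangMillsFor ∧ ∀ Δ, HasMassGap Δ ∧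
  HasLatticeMassGap Δ`: the summit's gap clauses are junk-reachable, only `IsNontrivial`/`IsNonGaussian` are not;
  the SHAPE of (B)'s conclusion is contentless, all strength is in the tuned hypotheses).
* §5 LOAD-BEARING HYPOTHESES (definitions + documented physics witnesses; no formal kill is possible because each
  kill needs a weak-coupling LOWER bound on truncated correlations, itself open):
  `WithoutBeta` (= rev 3; killed on paper by finite-β parasites: van Enter–Shlosman bulk first-order tail
  arXiv:cond-mat/0306362 Thm 2, Bhanot–Creutz endpoint doi:10.1103/physrevd.24.3212 — the reason for rev 4),
  `WithoutTuning` (killed on paper by over-fast `β_k`: `ξ(β_k) ≫ 1/a_k`, physical gap `M^{n_k}/ξ(β_k) → 0`),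
  `WithoutSimple` (NOT killed even on paper: `U(1)₄` Coulomb phase is gapless — barrier
  `Literature.Barriers.QuantumFields.AbelianDeconfinementD4` / conjecture `AbelianMasslessPhaseD4` — but its raw
  tuning amplitude is `D⁸⟨P;P⟩_D ≈ c/β² → 0` under `β_k → ∞`, so the hypotheses fail; the doubly weakened
  `WithoutSimpleAndBeta` IS physics-false at fixed `β > β_c(U(1))`; and `SU(2) × U(1)` with `ρ = 2 ⊕ 1` tunes through
  the `SU(2)` factor while the `U(1)` factor is gapless — "no abelian factor" is load-bearing for TRUTH, gen-1).
  `2 ≤ M`: decoration (§1). `0 < θ`: with `θ = 0` the over-fast-β sequences enter (same paper kill as WithoutTuning).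
* §6 STRENGTHENINGS (paper only; see the `§6` module docstring in the body): (i) a rate `Δ` uniform in `θ` is
  physics-false (two-branch structure of `u ↦ u⁸ G_{F²}(u)`: UV-branch tunings have crux-unit mass `u₁(θ) → 0`);
  (ii) a constant `C` uniform over observables is false by scaling `A ↦ λA` (provers need norms `‖Φ_k(F)Ω‖`, which
  converge by `IsYangMillsFor`, not a uniform `C`); (iii) `∀ k` in place of `∀ᶠ k` inside `HasLatticeMassGap`
  would import every finite `β_k`, including a critical endpoint met exactly (reducible `r`, Bhanot–Creutz) — the
  `∀ᶠ` is load-bearing for fat representations; (iv) "infinite gap" (all `Δ`) along tuned sequences is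
  physics-false (interacting limit) but formally as open as (S).
* §7 REGIMES TRIED (all dead): β ≡ 0 (product Haar: distant plaquettes independent, corr = 0, tuning fails — §4b, formal);
  subsingleton / finite / abelian `G` (excluded or corr amplitude → 0); finite-β critical points (excluded by
  `β_k → ∞`); `β = ∞` parasites (none: `U_p = 1` is the unique maximiser of `Re tr r` by faithfulness; mixed-action
  bulk lines sit at finite β); large-`N` bulk transition (Lucini–Teper–Wenger: finite β, first order — excluded);
  Patrascioiu–Seiler heterodoxy (a massless weak-coupling phase for `SU(2)₄` would make the tuning amplitude → 0,
  i.e. would kill (S), leaving (B) vacuous — it cannot refute (B)).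

* §8 TARGETS (gen 3, proved): see the `§8` module docstring in the body — verbatim copies of the 4 stub statements
  (namespace `DB`), `bridgeBody_of_rcc` / `bridgeChartExists_of_rcc` (certificate idle), `trivialStep`, `junkStep`,
  `bridgeBody_of_subsingleton`, `uniformLatticeGap_of_subsingleton`, `uvPassage_false_without_drift`,
  `uvPassage_false_without_absorption`; §8.4 `uvPassage_holds`, `scaleAnchoring_holds` (stubs 1 and 3 proved).

WHY IT RESISTS (one paragraph for the provers): the pair (`β_k → ∞`, `D_k⁸⟨P;τ_{D_k}P⟩ → θ > 0`, `D_k = M^{n_k}`)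
encodes dimensional transmutation: wherever lattice perturbation theory or a convergent expansion controls the
plaquette two-point function (`β = 0` cluster expansion, finite volume at `β → ∞`, Gaussian/spin-wave `U(1)`,
torons) the dimensionless amplitude carries a factor `β⁻²` and tends to `0`, so tuned sequences live exactly in
the non-perturbative crossover `D_k ≍ ξ(β_k)`; there the only candidate counterexample is a compact SIMPLE gauge
group with a massless weak-coupling phase AND a non-vanishing dimension-8 amplitude — no such model is known or
conjectured. A Lean kill additionally needs the (S)-type lower bound of §3.

PROVER NOTE (learned from the failed attacks on the transfer half). The naive transfer of the lattice bound
`|corr_k| ≤ C_{AB} e^{-Δ a_k n}` to smeared renormalised fields FAILS: the constant picks up `c_A(k) c_B(k) ~ a_k⁻⁸`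
and diverges. What transfers is POSITIVITY: with Lüscher's strictly positive transfer matrix (valid for periodic
time of ANY length, so the odd sides `2L+1`, `2S+1` are harmless) the truncated diagonal correlator of a
positive-time vector is a Laplace transform `∫ e^{-λt} dν_k(λ)` of a positive measure with `supp ν_k ⊆ [Δ, ∞)`
(from `HasLatticeMassGap` via `S → ∞` at fixed `k`) and total mass `ν_k(ℝ) = trunc_k(0)`, which CONVERGES by
`IsYangMillsFor` (the `t = 0` append tensor `ΘF̄ ⊗ F` is off-diagonal); weak limits of such measures keep
`supp ⊆ [Δ, ∞)`, giving `T.HasMassGap Δ` with `C = trunc(0)` for diagonal pairs and polarisation for the rest —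
modulo the density of off-diagonal product tensors among time-ordered append tensors (`schwinger_eq_of_isYangMillsFor`
pins `T` there). No observable-uniform constant is needed.

Gen-1 work files (v1 27 KB, v2 42 KB; evidence store `run/gate/evidence/stmt-QuantumFields-10523/…-Disproof.lean`,
not mounted on this hub) contain in addition: `schwinger_eq_of_isYangMillsFor` (fibre agreement on constrained
tensors), `exists_renorm_not_isYangMillsFor` (blow-up renormalisation empties the fibre), `UniformRate`,
`UniformConstantGap`, `crux_of_uniformRate`, and a §5 regime analysis; this v3 is a self-contained rebuild.
-/

namespace Summit.QuantumFields.YangMills.Cruxes.LatticeGapOnTrajectory.Disproof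

open Filter Topology MeasureTheory ProbabilityTheory
open Literature.MathematicalPhysics.QuantumFieldTheory Literature.MathematicalPhysics.QuantumLattice
open Summit.QuantumFields.YangMills.Theses.ParabolicTrajectory

noncomputable section

/-! ## §0 The crux, uncurried -/

section Anatomy

variable {G : Type} [Group G] [TopologicalSpace G] [IsTopologicalGroup G] [CompactSpace G]
  [MeasurableSpace G] [BorelSpace G]

/-- The hypothesis block of (B) at fixed data `(r, M, θ, sch, n)`: block factor, positive target, `M`-adic shape,
bare coupling to zero, and the non-perturbative tuning `a_k⁻⁸ ⟨P ; τ_{1/a_k} P⟩_k → θ`. [folklore] -/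
def Hyps (r : LatticeRep G) (M : ℕ) (θ : ℝ) (sch : SpeciesScheme (YMSpecies G)) (n : ℕ → ℕ) : Prop :=
  2 ≤ M ∧ 0 < θ ∧ (∀ k, sch.a k = ((M : ℝ) ^ n k)⁻¹) ∧ Tendsto sch.β atTop atTop ∧
    Tendsto (fun k => ((M : ℝ) ^ n k) ^ 8 *
      latticeConnectedCorr r.ρ (sch.β k) (sch.side k) r.curvature.F r.curvature.F (M ^ n k)) atTop (𝓝 θ)

/-- The transfer half of (B)'s conclusion at rate `Δ`: every OS continuum limit along `sch` up to species
renormalisations clusters at rate `Δ`. [folklore] -/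
def TransferHalf (r : LatticeRep G) (sch : SpeciesScheme (YMSpecies G)) (Δ : ℝ) : Prop :=
  ∀ sch' : SpeciesScheme (YMSpecies G), sch'.a = sch.a → sch'.β = sch.β → sch'.L = sch.L →
    ∀ T : OSData (YMSpecies G) 4, IsYangMillsFor r sch' T → T.HasMassGap Δ

/-- The conclusion of (B) at fixed data. [folklore] -/
def Concl (r : LatticeRep G) (sch : SpeciesScheme (YMSpecies G)) : Prop :=
  ∃ Δ : ℝ, 0 < Δ ∧ HasLatticeMassGap r sch Δ ∧ TransferHalf r sch Δ

end Anatomy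

/-- (B) uncurried: `LatticeGapOnTrajectory` is literally `∀ data, Hyps → Concl`. [folklore] -/
theorem crux_iff :
    LatticeGapOnTrajectory ↔
      ∀ (G : Type) [Group G] [TopologicalSpace G] [IsTopologicalGroup G] [CompactSpace G],
        IsCompactSimpleLieGroup G →
          letI : MeasurableSpace G := borel G
          haveI : BorelSpace G := ⟨rfl⟩
          ∀ (r : LatticeRep G) (M : ℕ) (θ : ℝ) (sch : SpeciesScheme (YMSpecies G)) (n : ℕ → ℕ),
            Hyps r M θ sch n → Concl r sch := by
  constructor
  · intro h G _ _ _ _ hG r M θ sch n hyp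
    exact h G hG r M θ sch n hyp.1 hyp.2.1 hyp.2.2.1 hyp.2.2.2.1 hyp.2.2.2.2
  · intro h G _ _ _ _ hG r M θ sch n hM hθ hs hβ ht
    exact h G hG r M θ sch n ⟨hM, hθ, hs, hβ, ht⟩

/-! ## §1 Shape: `2 ≤ M` is redundant; separation → ∞; no wrap-around -/

section Shape

variable {ι : Type}

/-- The `M`-adic shape `a_k = M^{-n_k}` together with the scheme axioms `a_k > 0`, `a_k → 0` already forces
`2 ≤ M`: for `M = 1` the spacing is constant `1`, for `M = 0` it is `1` (if `n_k = 0`) or the junk value `0⁻¹ = 0`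
(excluded by `a_pos`). Hence the crux's hypothesis `2 ≤ M` is decoration. [folklore] -/
theorem two_le_of_shape (sch : SpeciesScheme ι) {M : ℕ} {n : ℕ → ℕ}
    (h : ∀ k, sch.a k = ((M : ℝ) ^ n k)⁻¹) : 2 ≤ M := by
  by_contra hM
  push Not at hM
  have ha : ∀ k, sch.a k = 1 := by
    intro k
    have hk := h k
    have hpos := sch.a_pos k
    interval_cases M
    · rcases Nat.eq_zero_or_pos (n k) with h0 | h0
      · simpa [h0] using hk
      · exfalso
        rw [hk] at hpos
        simp [h0.ne'] at hpos
    · simpa using hk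
  have h1 : Tendsto sch.a atTop (𝓝 (1 : ℝ)) := by
    have : sch.a = fun _ => (1 : ℝ) := funext ha
    rw [this]
    exact tendsto_const_nhds
  have := tendsto_nhds_unique h1 sch.tendsto_a
  norm_num at this

/-- Under the shape hypothesis the tuned separation `M^{n_k} = a_k⁻¹` tends to infinity (in lattice units).
[folklore] -/
theorem tendsto_natPow_of_shape (sch : SpeciesScheme ι) {M : ℕ} {n : ℕ → ℕ}
    (h : ∀ k, sch.a k = ((M : ℝ) ^ n k)⁻¹) :
    Tendsto (fun k => ((M : ℝ) ^ n k)) atTop atTop := by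
  have hpos : Tendsto sch.a atTop (𝓝[>] (0 : ℝ)) :=
    tendsto_nhdsWithin_iff.2 ⟨sch.tendsto_a, Eventually.of_forall fun k => sch.a_pos k⟩
  have hinv : Tendsto (fun k => (sch.a k)⁻¹) atTop atTop := tendsto_inv_nhdsGT_zero.comp hpos
  refine hinv.congr fun k => ?_
  rw [h k, inv_inv]

/-- Under the shape hypothesis the exponents `n_k` tend to infinity. [folklore] -/
theorem tendsto_n_of_shape (sch : SpeciesScheme ι) {M : ℕ} {n : ℕ → ℕ}
    (h : ∀ k, sch.a k = ((M : ℝ) ^ n k)⁻¹) : Tendsto n atTop atTop := by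
  have hM := two_le_of_shape sch h
  have hpow := tendsto_natPow_of_shape sch h
  rw [tendsto_atTop_atTop] at hpow ⊢
  intro N
  obtain ⟨K, hK⟩ := hpow ((M : ℝ) ^ N + 1)
  refine ⟨K, fun k hk => ?_⟩
  by_contra hlt
  push Not at hlt
  have h1 : (1 : ℝ) ≤ M := by exact_mod_cast (by omega : 1 ≤ M)
  have hle : (M : ℝ) ^ n k ≤ (M : ℝ) ^ N := pow_le_pow_right₀ h1 hlt.le
  have := hK k hk
  linarith

/-- No wrap-around: eventually `M^{n_k} ≤ L_k`, so the tuned two-point function at separation `M^{n_k}` on the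
torus of side `2L_k + 1` is an honest (non-periodic-image) correlation at physical distance `1`. [folklore] -/
theorem eventually_sep_le_L (sch : SpeciesScheme ι) {M : ℕ} {n : ℕ → ℕ}
    (h : ∀ k, sch.a k = ((M : ℝ) ^ n k)⁻¹) : ∀ᶠ k in atTop, M ^ n k ≤ sch.L k := by
  have hM := two_le_of_shape sch h
  filter_upwards [sch.tendsto_L.eventually_ge_atTop 1] with k hk
  rw [h k] at hk
  have hc : (0 : ℝ) < (M : ℝ) ^ n k := by positivity
  have := (le_inv_mul_iff₀ hc).1 hk
  rw [mul_one] at this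
  exact_mod_cast this

end Shape

/-! ## §2 Logical anatomy: antitone halves, split conclusion -/

section Split

variable {G : Type} [Group G] [TopologicalSpace G] [IsTopologicalGroup G] [CompactSpace G]
  [MeasurableSpace G] [BorelSpace G] {ι : Type}

/-- The lattice half is antitone in the rate. [folklore] -/
theorem hasLatticeMassGap_anti (r : LatticeRep G) (sch : SpeciesScheme ι) {Δ Δ' : ℝ}
    (hΔ' : Δ' ≤ Δ) (h : HasLatticeMassGap r sch Δ) : HasLatticeMassGap r sch Δ' := by
  intro A B
  obtain ⟨C, hC⟩ := h A B
  refine ⟨max C 0, hC.mono fun k hk S hS n hn => (hk S hS n hn).trans ?_⟩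
  have hx : 0 ≤ sch.a k * n := mul_nonneg (sch.a_pos k).le (Nat.cast_nonneg n)
  calc C * Real.exp (-(Δ * (sch.a k * n)))
      ≤ max C 0 * Real.exp (-(Δ * (sch.a k * n))) :=
        mul_le_mul_of_nonneg_right (le_max_left _ _) (Real.exp_pos _).le
    _ ≤ max C 0 * Real.exp (-(Δ' * (sch.a k * n))) :=
        mul_le_mul_of_nonneg_left (Real.exp_le_exp.2 (by nlinarith)) (le_max_right _ _)

/-- The OS mass gap is antitone in the rate. [folklore] -/
theorem osData_hasMassGap_anti {d : ℕ} [NeZero d] (T : OSData ι d) {Δ Δ' : ℝ} (hΔ' : Δ' ≤ Δ)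
    (h : T.HasMassGap Δ) : T.HasMassGap Δ' := by
  intro n m k k' F G' hF hG
  obtain ⟨C, hC⟩ := h n m k k' F G' hF hG
  refine ⟨max C 0, fun t ht H hH => (hC t ht H hH).trans ?_⟩
  calc C * Real.exp (-Δ * t) ≤ max C 0 * Real.exp (-Δ * t) :=
        mul_le_mul_of_nonneg_right (le_max_left _ _) (Real.exp_pos _).le
    _ ≤ max C 0 * Real.exp (-Δ' * t) :=
        mul_le_mul_of_nonneg_left (Real.exp_le_exp.2 (by nlinarith)) (le_max_right _ _)

/-- The transfer half is antitone in the rate. [folklore] -/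
theorem transferHalf_anti (r : LatticeRep G) (sch : SpeciesScheme (YMSpecies G)) {Δ Δ' : ℝ}
    (hΔ' : Δ' ≤ Δ) (h : TransferHalf r sch Δ) : TransferHalf r sch Δ' :=
  fun sch' ha hb hL T hT => osData_hasMassGap_anti T hΔ' (h sch' ha hb hL T hT)

/-- (B)'s conclusion SPLITS: it holds iff the lattice half holds at some rate and the transfer half holds at
some (possibly different) rate — take the minimum. A prover may therefore close the two halves independently; a
disprover must kill one half at EVERY positive rate. [folklore] -/
theorem concl_iff_split (r : LatticeRep G) (sch : SpeciesScheme (YMSpecies G)) :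
    Concl r sch ↔ (∃ Δ : ℝ, 0 < Δ ∧ HasLatticeMassGap r sch Δ) ∧ (∃ Δ : ℝ, 0 < Δ ∧ TransferHalf r sch Δ) := by
  constructor
  · rintro ⟨Δ, hΔ, h1, h2⟩
    exact ⟨⟨Δ, hΔ, h1⟩, ⟨Δ, hΔ, h2⟩⟩
  · rintro ⟨⟨Δ₁, hΔ₁, h1⟩, ⟨Δ₂, hΔ₂, h2⟩⟩
    exact ⟨min Δ₁ Δ₂, lt_min hΔ₁ hΔ₂, hasLatticeMassGap_anti r sch (min_le_left _ _) h1,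
      transferHalf_anti r sch (min_le_right _ _) h2⟩

end Split

/-! ## §3 Disproof burden: `¬(B)` proves the `∃`-core of (S) -/

/-- **A tuned asymptotically-free Wilson sequence exists**: some compact simple `G`, faithful unitary `r`, block
factor `M`, target `θ > 0` and `M`-adic scheme with `β_k → ∞` satisfy the hypothesis block of (B). This is the
`∃`-core of the route's conjunct (S) `TunedSequenceExists` (which asks it for EVERY `G, r, M` and every small `θ`,
with all `N_t` convergent); it is OPEN (needs a LOWER bound `sup_β D⁸⟨P;τ_D P⟩_β ≥ θ` at large `D`, a quantitative
`ξ(β) → ∞`, Chatterjee arXiv:1803.01950 Problem 5.1). [folklore] -/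
def TunedWitnessExists : Prop :=
  ∃ (G : Type) (_ : Group G) (_ : TopologicalSpace G) (_ : IsTopologicalGroup G) (_ : CompactSpace G),
    IsCompactSimpleLieGroup G ∧
      letI : MeasurableSpace G := borel G
      haveI : BorelSpace G := ⟨rfl⟩
      ∃ (r : LatticeRep G) (M : ℕ) (θ : ℝ) (sch : SpeciesScheme (YMSpecies G)) (n : ℕ → ℕ), Hyps r M θ sch n

/-- In a world with no tuned asymptotically-free Wilson sequence, (B) holds vacuously. [folklore] -/
theorem crux_of_not_tunedWitnessExists (h : ¬ TunedWitnessExists) : LatticeGapOnTrajectory := by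
  intro G _ _ _ _ hG r M θ sch n hM hθ hs hβ ht
  exact (h ⟨G, _, _, _, _, hG, r, M, θ, sch, n, hM, hθ, hs, hβ, ht⟩).elim

/-- **Disproof burden.** Any refutation of (B) exhibits a tuned asymptotically-free Wilson sequence, i.e. proves
the open `∃`-core of (S) — before any gaplessness is shown. [folklore] -/
theorem tunedWitnessExists_of_not_crux (h : ¬ LatticeGapOnTrajectory) : TunedWitnessExists := by
  by_contra h'
  exact h (crux_of_not_tunedWitnessExists h')

/-- (S) implies the `∃`-core (instantiate at `G = SU(2)`, which the tree PROVES compact simple: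
`isSimpleCompactGroup_specialUnitaryGroup_holds`). So the route's own conjunct (S) is exactly what a disprover of
(B) would have to establish first. [folklore] -/
theorem tunedWitnessExists_of_tunedSequenceExists (hS : TunedSequenceExists) : TunedWitnessExists := by
  have hG : IsCompactSimpleLieGroup (Matrix.specialUnitaryGroup (Fin 2) ℂ) :=
    isCompactSimpleLieGroup_specialUnitaryGroup isSimpleCompactGroup_specialUnitaryGroup_holds le_rfl
  obtain ⟨θ₀, hθ₀, h⟩ := hS (Matrix.specialUnitaryGroup (Fin 2) ℂ) hG (Classical.choice hG.2) 2 le_rfl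
  obtain ⟨sch, n, hshape, hβ, -, htune⟩ := h (θ₀ / 2) (by positivity) (by linarith)
  exact ⟨Matrix.specialUnitaryGroup (Fin 2) ℂ, inferInstance, inferInstance, inferInstance, inferInstance, hG,
    Classical.choice hG.2, 2, θ₀ / 2, sch, n, le_rfl, by positivity, hshape, hβ, htune⟩

/-- Equivalently: (B) fails only in worlds where tuned AF sequences exist — `(B) ∨ TunedWitnessExists`.
[folklore] -/
theorem crux_or_tunedWitnessExists : LatticeGapOnTrajectory ∨ TunedWitnessExists := by
  by_cases hB : LatticeGapOnTrajectory
  · exact Or.inl hB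
  · exact Or.inr (tunedWitnessExists_of_not_crux hB)

/-! ## §4 Junk audit: trivial gauge group; the transfer fibre at `c = m = 0` -/

section Junk

variable {G : Type} [Group G] [TopologicalSpace G] [IsTopologicalGroup G] [CompactSpace G]
  [MeasurableSpace G] [BorelSpace G]

/-- The `Z⁻¹`-normalised Wilson measure always has total mass `0` or `1` (mass `1` exactly when
`0 < Z < ∞`, which holds for continuous `ρ`; the junk branches are `Z = 0` and `Z = ∞`). [folklore] -/
theorem wilsonMeasure_real_univ {N : ℕ} (ρ : G →* Matrix (Fin N) (Fin N) ℂ) (β : ℝ) (S : ℕ) [NeZero S] :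
    (wilsonMeasure (d := 4) (L := S) ρ β).real Set.univ = 0 ∨
      (wilsonMeasure (d := 4) (L := S) ρ β).real Set.univ = 1 := by
  set Z := partitionFunction (d := 4) (L := S) ρ β with hZ
  have hμ : (wilsonMeasure (d := 4) (L := S) ρ β) Set.univ = Z⁻¹ * Z := by
    simp [wilsonMeasure, partitionFunction, hZ]
  rw [measureReal_def, hμ]
  by_cases h0 : Z = 0
  · left; simp [h0]
  by_cases ht : Z = ⊤
  · left; simp [ht]
  · right; simp [ENNReal.inv_mul_cancel h0 ht]

/-- For a trivial (subsingleton) gauge group every lattice observable is constant, so every connected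
correlation vanishes identically — at every coupling, volume and separation. [folklore] -/
theorem latticeConnectedCorr_eq_zero_of_subsingleton [Subsingleton G] {N : ℕ}
    (ρ : G →* Matrix (Fin N) (Fin N) ℂ) (β : ℝ) (S : ℕ) [NeZero S] (A B : LGConfig 4 G → ℝ) (n : ℕ) :
    latticeConnectedCorr ρ β S A B n = 0 := by
  obtain ⟨a0, rfl⟩ : ∃ a0 : ℝ, A = fun _ => a0 := ⟨A 1, funext fun U => congrArg A (Subsingleton.elim _ _)⟩
  obtain ⟨b0, rfl⟩ : ∃ b0 : ℝ, B = fun _ => b0 := ⟨B 1, funext fun U => congrArg B (Subsingleton.elim _ _)⟩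
  unfold latticeConnectedCorr
  simp only [integral_const, smul_eq_mul]
  rcases wilsonMeasure_real_univ (G := G) ρ β S with h | h <;> rw [h] <;> ring

/-- Hence for a trivial gauge group the hypothesis block of (B) is UNSATISFIABLE (the tuning asks a sequence of
zeros to converge to `θ > 0`): dropping `IsCompactSimpleLieGroup` does not let a junk group refute (B); finite and
abelian groups are excluded by `IsSimpleCompactGroup` (connected, non-abelian) anyway. [folklore] -/
theorem not_hyps_of_subsingleton [Subsingleton G] (r : LatticeRep G) (M : ℕ) (θ : ℝ)
    (sch : SpeciesScheme (YMSpecies G)) (n : ℕ → ℕ) : ¬ Hyps r M θ sch n := by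
  rintro ⟨-, hθ, -, -, ht⟩
  have h0 : Tendsto (fun k => ((M : ℝ) ^ n k) ^ 8 *
      latticeConnectedCorr r.ρ (sch.β k) (sch.side k) r.curvature.F r.curvature.F (M ^ n k))
      atTop (𝓝 0) := by
    simp only [latticeConnectedCorr_eq_zero_of_subsingleton, mul_zero]
    exact tendsto_const_nhds
  have := tendsto_nhds_unique ht h0
  exact hθ.ne' this

/-- The scheme `sch` with all species renormalisations switched off (`c = m = 0`), same `(a, β, L)`. [folklore] -/
def zeroRenorm {ι : Type} (sch : SpeciesScheme ι) : SpeciesScheme ι where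
  a := sch.a
  a_pos := sch.a_pos
  tendsto_a := sch.tendsto_a
  β := sch.β
  L := sch.L
  tendsto_L := sch.tendsto_L
  c := fun _ _ => 0
  m := fun _ _ => 0

/-- With `c = 0` every lattice Schwinger function of positive degree vanishes. [folklore] -/
theorem latticeSchwinger_zeroRenorm {N : ℕ} (ρ : G →* Matrix (Fin N) (Fin N) ℂ)
    (sch : SpeciesScheme (YMSpecies G)) (k n : ℕ) (hn : n ≠ 0) (σ : Fin n → YMSpecies G)
    (f : Fin n → SchwartzMap (EuclideanSpace ℝ (Fin 4)) ℝ) :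
    latticeSchwinger ρ (zeroRenorm sch) (fun s => s.F) k n σ f = 0 := by
  obtain ⟨j, rfl⟩ := Nat.exists_eq_succ_of_ne_zero hn
  simp [latticeSchwinger, smearedLatticeField, zeroRenorm]

/-- The vacuum-only theory is a continuum limit along `zeroRenorm sch`, for EVERY `(a, β, L)`. [folklore] -/
theorem isYangMillsFor_zeroRenorm_vacuum (r : LatticeRep G) (sch : SpeciesScheme (YMSpecies G)) :
    IsYangMillsFor r (zeroRenorm sch) (OSData.vacuum (YMSpecies G) 4) := by
  intro n hn σ f F _ _
  have hS : (OSData.vacuum (YMSpecies G) 4).schwinger n σ F = 0 := by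
    simp [OSData.vacuum, Literature.MathematicalPhysics.AQFT.LabelledSchwingerFamily.trivial_of_ne_zero
      (YMSpecies G) hn]
  rw [hS]
  refine tendsto_const_nhds.congr' (Eventually.of_forall fun k => ?_)
  change (0 : ℂ) = ((latticeSchwinger r.ρ (zeroRenorm sch) (fun s => s.F) k n σ f : ℝ) : ℂ)
  rw [latticeSchwinger_zeroRenorm r.ρ sch k n hn σ f]
  simp

/-- **The transfer fibre is inhabited by a gapped junk theory, for every `(r, sch, Δ)`**: `sch' = zeroRenorm sch`
shares `(a, β, L)` with `sch`, the vacuum-only OS datum is a continuum limit along it, and it has every mass gap.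
So the `∀ sch' T` clause of (B) is non-vacuous and cannot be refuted by junk renormalisations: a refutation of the
transfer half needs a GENUINE (non-trivially renormalised) continuum limit without gap `Δ`. [folklore] -/
theorem transferHalf_inhabited (r : LatticeRep G) (sch : SpeciesScheme (YMSpecies G)) (Δ : ℝ) :
    ∃ (sch' : SpeciesScheme (YMSpecies G)) (T : OSData (YMSpecies G) 4),
      sch'.a = sch.a ∧ sch'.β = sch.β ∧ sch'.L = sch.L ∧ IsYangMillsFor r sch' T ∧ T.HasMassGap Δ :=
  ⟨zeroRenorm sch, OSData.vacuum _ 4, rfl, rfl, rfl, isYangMillsFor_zeroRenorm_vacuum r sch,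
    OSData.vacuum_hasMassGap Δ⟩

/-- **Fibre agreement.** Two OS data that are continuum limits along the SAME renormalised scheme agree on every
constrained tensor (off-diagonal real product tensors, positive degree): limits are unique. So within one fibre of
the transfer clause the `∀ T` ranges over extensions of ONE functional from the constrained tensors; whether that
pins `HasMassGap` is a density question (time-ordered append-tensors lie in the closure of the span of
off-diagonal products) — prover-side. [folklore] -/
theorem schwinger_eq_of_isYangMillsFor (r : LatticeRep G) (sch' : SpeciesScheme (YMSpecies G))
    {T₁ T₂ : OSData (YMSpecies G) 4} (h₁ : IsYangMillsFor r sch' T₁) (h₂ : IsYangMillsFor r sch' T₂)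
    {n : ℕ} (hn : n ≠ 0) (σ : Fin n → YMSpecies G) (f : Fin n → SchwartzMap (EuclideanSpace ℝ (Fin 4)) ℝ)
    (F : SchwartzMap (Fin n → EuclideanSpace ℝ (Fin 4)) ℂ) (hF : IsTensorOf F fun i => ofRealTest (f i))
    (hoff : Literature.MathematicalPhysics.AQFT.IsOffDiagonal F) :
    T₁.schwinger n σ F = T₂.schwinger n σ F :=
  tendsto_nhds_unique (h₁ n hn σ f F hF hoff) (h₂ n hn σ f F hF hoff)

variable (G) in
/-- The constant gauge-invariant observable `1` (empty support). [folklore] -/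
def oneObs : YMSpecies G where
  F := fun _ => 1
  supp := ∅
  isCylinder := fun _ _ _ => rfl
  gaugeInvariant := fun _ _ => rfl
  bounded := ⟨1, fun _ => by simp⟩
  measurable := measurable_const

/-- The scheme `sch` with the blow-up renormalisation `c_s(k) = k · a_k⁻⁴`, `m = 0` on every species. [folklore] -/
def blowUp {ι : Type} (sch : SpeciesScheme ι) : SpeciesScheme ι where
  a := sch.a
  a_pos := sch.a_pos
  tendsto_a := sch.tendsto_a
  β := sch.β
  L := sch.L
  tendsto_L := sch.tendsto_L
  c := fun _ k => (k : ℝ) * ((sch.a k) ^ 4)⁻¹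
  m := fun _ _ => 0

/-- A nonnegative real test function equal to `1` at the origin (a smooth bump). [folklore] -/
theorem exists_bump_test :
    ∃ f : SchwartzMap (EuclideanSpace ℝ (Fin 4)) ℝ, (∀ x, 0 ≤ f x) ∧ f 0 = 1 := by
  let χ : ContDiffBump (0 : EuclideanSpace ℝ (Fin 4)) := ⟨1, 2, one_pos, one_lt_two⟩
  refine ⟨χ.hasCompactSupport.toSchwartzMap χ.contDiff, fun x => χ.nonneg, ?_⟩
  show (χ : EuclideanSpace ℝ (Fin 4) → ℝ) 0 = 1
  exact χ.one_of_mem_closedBall (Metric.mem_closedBall_self (le_of_lt χ.rIn_pos))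

/-- The degree-one lattice Schwinger function of the constant observable under the blow-up renormalisation is the
deterministic number `k · ∑_{x ∈ Λ_k} f(a_k x)`. [folklore] -/
theorem latticeSchwinger_blowUp_one (r : LatticeRep G) (sch : SpeciesScheme (YMSpecies G)) (k : ℕ)
    (f : SchwartzMap (EuclideanSpace ℝ (Fin 4)) ℝ) :
    latticeSchwinger r.ρ (blowUp sch) (fun s => s.F) k 1 (fun _ => oneObs G) (fun _ => f) =
      (k : ℝ) * ∑ x ∈ Literature.Probability.LatticeModels.box 4 (sch.L k), f (sch.a k • siteToE x) := by
  haveI := isProbabilityMeasure_wilsonMeasure (d := 4) (L := (blowUp sch).side k) r.ρ r.continuous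
    ((blowUp sch).β k)
  have hval : ∀ U : LGConfig 4 G, smearedLatticeField (oneObs G).F (Literature.Probability.LatticeModels.box 4 ((blowUp sch).L k))
      ((blowUp sch).a k) ((blowUp sch).c (oneObs G) k) ((blowUp sch).m (oneObs G) k) f U =
        (k : ℝ) * ∑ x ∈ Literature.Probability.LatticeModels.box 4 (sch.L k), f (sch.a k • siteToE x) := by
    intro U
    have ha : (sch.a k) ^ 4 ≠ 0 := pow_ne_zero 4 (sch.a_pos k).ne'
    simp only [smearedLatticeField, oneObs, blowUp, sub_zero, mul_one]
    rw [mul_assoc (k : ℝ), inv_mul_cancel₀ ha, mul_one]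
  simp only [latticeSchwinger, Finset.univ_unique, Finset.prod_singleton, hval, integral_const, smul_eq_mul,
    probReal_univ, one_mul]

/-- **Blow-up renormalisations EMPTY the transfer fibre.** For every scheme there is a renormalisation with the same
`(a, β, L)` along which NO OS datum is a continuum limit: the degree-one function of the constant observable against
a bump test function is `≥ k`. So the `(c, m)` in `sch'` are witness data — they can trivialise (`c = 0`,
`transferHalf_inhabited`) or empty the fibre, never manufacture a gapless limit by themselves. [folklore] -/
theorem exists_renorm_not_isYangMillsFor (r : LatticeRep G) (sch : SpeciesScheme (YMSpecies G)) :
    ∃ sch' : SpeciesScheme (YMSpecies G), sch'.a = sch.a ∧ sch'.β = sch.β ∧ sch'.L = sch.L ∧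
      ∀ T : OSData (YMSpecies G) 4, ¬ IsYangMillsFor r sch' T := by
  refine ⟨blowUp sch, rfl, rfl, rfl, fun T hT => ?_⟩
  obtain ⟨f, hf0, hf1⟩ := exists_bump_test
  have hoff : Literature.MathematicalPhysics.AQFT.IsOffDiagonal
      (SchwartzMap.tensorFin 1 fun _ : Fin 1 => ofRealTest f) := by
    intro x hx
    obtain ⟨i, j, hij, -⟩ := hx
    exact absurd (Subsingleton.elim i j) hij
  have h := hT 1 one_ne_zero (fun _ => oneObs G) (fun _ => f) _ (isTensorOf_tensorFin _) hoff
  -- the lattice side is the real sequence k ↦ k · Σ f(a_k x) ≥ k, cast to ℂ: unbounded, hence not convergent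
  have hge : ∀ k : ℕ, (k : ℝ) ≤ latticeSchwinger r.ρ (blowUp sch) (fun s => s.F) k 1 (fun _ => oneObs G)
      (fun _ => f) := by
    intro k
    rw [latticeSchwinger_blowUp_one]
    have hsum : 1 ≤ ∑ x ∈ Literature.Probability.LatticeModels.box 4 (sch.L k), f (sch.a k • siteToE x) := by
      have h0 : f (sch.a k • siteToE (0 : Literature.Probability.LatticeModels.Site 4)) = 1 := by
        have : siteToE (0 : Literature.Probability.LatticeModels.Site 4) = 0 := by
          ext i; simp [siteToE_apply]
        rw [this, smul_zero, hf1]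
      calc (1 : ℝ) = f (sch.a k • siteToE (0 : Literature.Probability.LatticeModels.Site 4)) := h0.symm
        _ ≤ ∑ x ∈ Literature.Probability.LatticeModels.box 4 (sch.L k), f (sch.a k • siteToE x) :=
          Finset.single_le_sum (f := fun x => f (sch.a k • siteToE x)) (fun x _ => hf0 _)
            (Literature.Probability.LatticeModels.zero_mem_box 4 (sch.L k))
    calc (k : ℝ) = k * 1 := (mul_one _).symm
      _ ≤ k * ∑ x ∈ Literature.Probability.LatticeModels.box 4 (sch.L k), f (sch.a k • siteToE x) :=
        mul_le_mul_of_nonneg_left hsum (Nat.cast_nonneg k)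
  set Lk : ℕ → ℝ := fun k => latticeSchwinger r.ρ (blowUp sch) (fun s => s.F) k 1 (fun _ => oneObs G)
    (fun _ => f) with hLk
  have hnorm : ∀ k : ℕ, ‖((Lk k : ℝ) : ℂ)‖ = Lk k := fun k => by
    rw [Complex.norm_real, Real.norm_of_nonneg ((Nat.cast_nonneg k).trans (hge k))]
  have hev₁ : ∀ᶠ k : ℕ in atTop, ‖((Lk k : ℝ) : ℂ)‖ < ‖T.schwinger 1 (fun _ => oneObs G)
      (SchwartzMap.tensorFin 1 fun _ : Fin 1 => ofRealTest f)‖ + 1 :=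
    h.norm.eventually_lt_const (lt_add_one _)
  have hev₂ : ∀ᶠ k : ℕ in atTop, ‖T.schwinger 1 (fun _ => oneObs G)
      (SchwartzMap.tensorFin 1 fun _ : Fin 1 => ofRealTest f)‖ + 1 < (k : ℝ) :=
    tendsto_natCast_atTop_atTop.eventually_gt_atTop _
  obtain ⟨k, hk₁, hk₂⟩ := (hev₁.and hev₂).exists
  rw [hnorm] at hk₁
  have := hge k
  linarith


end Junk

/-! ## §4b Zero coupling: ultralocality of the product Haar measure (the `β ≡ 0` direction, formal) -/

section ProductMeasure

/-- Pad a partial configuration on the finite index set `I` by `1` off `I`. [folklore] -/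
def padI {κ G : Type*} [One G] (I : Finset κ) [DecidableEq κ] (u : ↥I → G) : κ → G :=
  fun e => if h : e ∈ I then u ⟨e, h⟩ else 1

/-- Padding is measurable. [folklore] -/
theorem measurable_padI {κ G : Type*} [One G] [MeasurableSpace G] (I : Finset κ) [DecidableEq κ] :
    Measurable (padI (G := G) I) := by
  refine measurable_pi_lambda _ fun e => ?_
  by_cases he : e ∈ I
  · simp only [padI, he, dite_true]; exact measurable_pi_apply _
  · simp only [padI, he, dite_false]; exact measurable_const

/-- A function depending only on the coordinates in `I` factors through the restriction to `I`. [folklore] -/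
theorem apply_padI_restrict {κ G α : Type*} [One G] (I : Finset κ) [DecidableEq κ] {f : (κ → G) → α}
    (hf : DependsOn f (↑I : Set κ)) (U : κ → G) : f (padI I (I.restrict U)) = f U := by
  refine hf fun e he => ?_
  simp [padI, Finset.mem_coe.1 he]

/-- **Ultralocality of a product measure.** Under a product probability measure, measurable real functions
depending on DISJOINT finite sets of coordinates are uncorrelated: `∫ f g = ∫ f · ∫ g`. [folklore] -/
theorem integral_mul_eq_of_dependsOn_disjoint {κ G : Type*} [Fintype κ] [DecidableEq κ] [One G]
    [MeasurableSpace G] (ν : Measure G) [IsProbabilityMeasure ν]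
    {f g : (κ → G) → ℝ} (I J : Finset κ) (hIJ : Disjoint I J)
    (hf : DependsOn f (↑I : Set κ)) (hg : DependsOn g (↑J : Set κ))
    (hfm : Measurable f) (hgm : Measurable g) :
    ∫ U, f U * g U ∂(Measure.pi fun _ : κ => ν) =
      (∫ U, f U ∂(Measure.pi fun _ : κ => ν)) * ∫ U, g U ∂(Measure.pi fun _ : κ => ν) := by
  have hind : iIndepFun (fun (e : κ) (U : κ → G) => U e) (Measure.pi fun _ : κ => ν) :=
    iIndepFun_pi (X := fun _ : κ => @id G) fun _ => aemeasurable_id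
  have hIJ' : IndepFun (fun (U : κ → G) (i : ↥I) => U i) (fun (U : κ → G) (j : ↥J) => U j)
      (Measure.pi fun _ : κ => ν) :=
    hind.indepFun_finset I J hIJ fun e => measurable_pi_apply e
  have hcomp : IndepFun ((f ∘ padI I) ∘ fun (U : κ → G) (i : ↥I) => U i)
      ((g ∘ padI J) ∘ fun (U : κ → G) (j : ↥J) => U j) (Measure.pi fun _ : κ => ν) :=
    hIJ'.comp (hfm.comp (measurable_padI I)) (hgm.comp (measurable_padI J))
  have hf' : ((f ∘ padI I) ∘ fun (U : κ → G) (i : ↥I) => U i) = f := by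
    funext U; exact apply_padI_restrict I hf U
  have hg' : ((g ∘ padI J) ∘ fun (U : κ → G) (j : ↥J) => U j) = g := by
    funext U; exact apply_padI_restrict J hg U
  rw [hf', hg'] at hcomp
  have := hcomp.integral_mul_eq_mul_integral hfm.aestronglyMeasurable hgm.aestronglyMeasurable
  simpa using this

end ProductMeasure

section Cylinder

variable {G : Type}

/-- A cylinder observable of the infinite lattice, evaluated on periodic lifts, depends only on the torus edges
below its support. [folklore] -/
theorem dependsOn_comp_torusLift {α : Type*} {F : LGConfig 4 G → α} {SF : Finset (Literature.MathematicalPhysics.QuantumLattice.ZdEdge 4)}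
    (hF : IsCylinder F SF) (S : ℕ) :
    DependsOn (fun U : GaugeConfig 4 S G => F (torusLift S U))
      (↑(SF.image (torusEdge S)) : Set (Edge 4 S)) := by
  intro U V hUV
  refine hF fun e he => ?_
  simp only [torusLift, Function.comp_apply]
  exact hUV (torusEdge S e) (Finset.mem_coe.2 (Finset.mem_image_of_mem _ (Finset.mem_coe.1 he)))

/-- The torus edges seen by an observable of support `SB` translated by `n` lattice units in Euclidean time.
[folklore] -/
def shiftedTorusSupport (SB : Finset (Literature.MathematicalPhysics.QuantumLattice.ZdEdge 4)) (S n : ℕ) : Finset (Edge 4 S) :=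
  (SB.image fun e : Literature.MathematicalPhysics.QuantumLattice.ZdEdge 4 =>
    (e.1 - -(Pi.single 0 (n : ℤ) : Literature.Probability.LatticeModels.Site 4), e.2)).image (torusEdge S)

end Cylinder

section ZeroCoupling

variable {G : Type} [Group G] [TopologicalSpace G] [IsTopologicalGroup G] [CompactSpace G]
  [MeasurableSpace G] [BorelSpace G]

/-- At zero coupling the Wilson measure IS the product Haar measure (density `e⁰ = 1`, `Z = 1`). [folklore] -/
theorem wilsonMeasure_zero_coupling {N : ℕ} (ρ : G →* Matrix (Fin N) (Fin N) ℂ) (S : ℕ) [NeZero S] :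
    wilsonMeasure (d := 4) (L := S) ρ 0 = Measure.pi fun _ : Edge 4 S => haarProbability G := by
  have hW : wilsonWeight (d := 4) (L := S) ρ 0 = Measure.pi fun _ : Edge 4 S => haarProbability G := by
    have h1 : (fun U : GaugeConfig 4 S G => ENNReal.ofReal (Real.exp (-0 * wilsonAction ρ U))) = 1 := by
      funext U; simp
    simp only [wilsonWeight, h1, withDensity_one]
  have hZ : partitionFunction (d := 4) (L := S) ρ 0 = 1 := by
    simp only [partitionFunction, hW, measure_univ]
  rw [wilsonMeasure, hZ, hW, inv_one, one_smul]

/-- Torus Wilson expectations are invariant under the time translation used in `latticeConnectedCorr`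
(tree: `wilsonExpectation_comp_torusConfigShift` + `toTorusObservable_comp_configShift`). [folklore] -/
theorem integral_comp_configShift_torusLift {N : ℕ} (ρ : G →* Matrix (Fin N) (Fin N) ℂ) (β : ℝ) (S : ℕ)
    [NeZero S] (B : LGConfig 4 G → ℝ) (v : Literature.Probability.LatticeModels.Site 4) :
    ∫ U, B (configShift v (torusLift S U)) ∂(wilsonMeasure (d := 4) (L := S) ρ β) =
      ∫ U, B (torusLift S U) ∂(wilsonMeasure (d := 4) (L := S) ρ β) := by
  have h := wilsonExpectation_comp_torusConfigShift (d := 4) (L := S) ρ β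
    (Literature.Probability.LatticeModels.Torus.proj S v) (toTorusObservable S B)
  rw [← toTorusObservable_comp_configShift] at h
  simpa [wilsonExpectation, toTorusObservable, Function.comp_apply] using h

/-- **Zero-coupling ultralocality.** At `β = 0` the connected torus correlation of two gauge-invariant local
observables vanishes EXACTLY as soon as the torus projections of `supp A` and of `supp B + n e₀` are disjoint
(independent Haar links). [folklore] -/
theorem latticeConnectedCorr_zero_coupling {N : ℕ} (ρ : G →* Matrix (Fin N) (Fin N) ℂ) (S : ℕ) [NeZero S]
    (A B : YMSpecies G) (n : ℕ)
    (hdisj : Disjoint (A.supp.image (torusEdge S)) (shiftedTorusSupport B.supp S n)) :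
    latticeConnectedCorr ρ 0 S A.F B.F n = 0 := by
  unfold latticeConnectedCorr
  rw [← integral_comp_configShift_torusLift ρ 0 S B.F (-Pi.single 0 (n : ℤ)),
    wilsonMeasure_zero_coupling ρ S]
  have hA : DependsOn (fun U : GaugeConfig 4 S G => A.F (torusLift S U))
      (↑(A.supp.image (torusEdge S)) : Set (Edge 4 S)) := dependsOn_comp_torusLift A.isCylinder S
  have hB : DependsOn (fun U : GaugeConfig 4 S G =>
      B.F (configShift (-Pi.single 0 (n : ℤ)) (torusLift S U)))
      (↑(shiftedTorusSupport B.supp S n) : Set (Edge 4 S)) :=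
    dependsOn_comp_torusLift (IsCylinder.comp_configShift B.isCylinder _) S
  have hmA : Measurable fun U : GaugeConfig 4 S G => A.F (torusLift S U) :=
    A.measurable.comp (measurable_torusLift S)
  have hmB : Measurable fun U : GaugeConfig 4 S G =>
      B.F (configShift (-Pi.single 0 (n : ℤ)) (torusLift S U)) :=
    B.measurable.comp ((configShift _).measurable.comp (measurable_torusLift S))
  rw [integral_mul_eq_of_dependsOn_disjoint (haarProbability G) _ _ hdisj hA hB hmA hmB, sub_self]

end ZeroCoupling

section ZeroCouplingTuning

variable {G : Type} [Group G] [TopologicalSpace G] [IsTopologicalGroup G] [CompactSpace G]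
  [MeasurableSpace G] [BorelSpace G]

/-- Every edge in the support of the curvature species `tr F²` (the six origin plaquettes) has time coordinate
`0` or `1` at its base point. [folklore] -/
theorem curvature_supp_time (r : LatticeRep G) :
    ∀ e ∈ r.curvature.supp, e.1 0 = 0 ∨ e.1 0 = 1 := by
  intro e he
  have he' : e ∈ Finset.univ.biUnion fun p : Fin 4 × Fin 4 => originPlaquetteSupport (d := 4) p.1 p.2 := he
  simp only [Finset.mem_biUnion, Finset.mem_univ, true_and, originPlaquetteSupport, Finset.mem_insert,
    Finset.mem_singleton] at he'
  obtain ⟨⟨i, j⟩, h | h | h | h⟩ := he' <;> subst h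
  · exact Or.inl rfl
  · by_cases hi : (0 : Fin 4) = i
    · subst hi; exact Or.inr (by simp)
    · exact Or.inl (by simp [Pi.single_eq_of_ne hi])
  · by_cases hj : (0 : Fin 4) = j
    · subst hj; exact Or.inr (by simp)
    · exact Or.inl (by simp [Pi.single_eq_of_ne hj])
  · exact Or.inl rfl

/-- For time separations `2 ≤ n ≤ S - 2` the torus projections of the curvature support and of its translate
by `n e₀` are disjoint (no shared links, no wrap-around). [folklore] -/
theorem disjoint_curvature_torusSupports (r : LatticeRep G) {S n : ℕ} (hn : 2 ≤ n) (hnS : n + 2 ≤ S) :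
    Disjoint (r.curvature.supp.image (torusEdge S)) (shiftedTorusSupport r.curvature.supp S n) := by
  rw [Finset.disjoint_left]
  rintro a ha hb
  rw [Finset.mem_image] at ha
  obtain ⟨e₁, he₁, rfl⟩ := ha
  simp only [shiftedTorusSupport, Finset.mem_image] at hb
  obtain ⟨e₂', ⟨e₂, he₂, rfl⟩, heq⟩ := hb
  have h1 := curvature_supp_time r e₁ he₁
  have h2 := curvature_supp_time r e₂ he₂
  have h0 : (((e₂.1 0 + (n : ℤ) : ℤ)) : ZMod S) = ((e₁.1 0 : ℤ) : ZMod S) := by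
    have := congrArg (fun E : Edge 4 S => E.1 0) heq
    simpa [torusEdge, Literature.Probability.LatticeModels.Torus.proj] using this
  rw [ZMod.intCast_eq_intCast_iff_dvd_sub] at h0
  -- h0 : (S : ℤ) ∣ e₁.1 0 - (e₂.1 0 + n)
  have hdvd : (S : ℤ) ∣ (e₂.1 0 + n) - e₁.1 0 := dvd_sub_comm.1 h0
  have hpos : (0 : ℤ) < (e₂.1 0 + n) - e₁.1 0 := by rcases h1 with h1 | h1 <;> rcases h2 with h2 | h2 <;> omega
  have hle := Int.le_of_dvd hpos hdvd
  rcases h1 with h1 | h1 <;> rcases h2 with h2 | h2 <;> omega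

/-- **At zero coupling the tuned correlator is EXACTLY zero, eventually** (for every `M`-adic scheme): once
`2 ≤ M^{n_k} ≤ L_k`, the origin plaquettes and their translate by `M^{n_k} e₀` share no torus link, so the
product Haar measure decorrelates them. This is the left IVT endpoint `N₁(k, β = 0) = 0` that the (S)-provers
need, and it closes the `β ≡ 0` junk direction against the rev-3 statement `WithoutBeta`. [folklore] -/
theorem curvatureCorr_zero_coupling_eventually (r : LatticeRep G) (sch : SpeciesScheme (YMSpecies G))
    {M : ℕ} {n : ℕ → ℕ} (hs : ∀ k, sch.a k = ((M : ℝ) ^ n k)⁻¹) :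
    ∀ᶠ k in atTop,
      latticeConnectedCorr r.ρ 0 (sch.side k) r.curvature.F r.curvature.F (M ^ n k) = 0 := by
  have hM := two_le_of_shape sch hs
  filter_upwards [eventually_sep_le_L sch hs, (tendsto_n_of_shape sch hs).eventually_ge_atTop 1]
    with k hk hk1
  have h1 : 1 ≤ M ^ n k := Nat.one_le_pow _ _ (by omega)
  have h2 : 2 ≤ M ^ n k :=
    calc 2 ≤ M := hM
      _ = M ^ 1 := (pow_one M).symm
      _ ≤ M ^ n k := Nat.pow_le_pow_right (by omega) hk1
  refine latticeConnectedCorr_zero_coupling r.ρ (sch.side k) r.curvature r.curvature (M ^ n k)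
    (disjoint_curvature_torusSupports r h2 ?_)
  simp only [SpeciesScheme.side]
  omega

/-- Hence along any scheme whose coupling is eventually `0` the dimensionless tuned correlator tends to `0`,
so the tuning hypothesis with `θ ≠ 0` FAILS: the rev-3 statement `WithoutBeta` is not junk-refutable at
`β ≡ 0` (and, read positively, `N₁(k, 0) → 0` is the cheap half of the IVT in (S)). [folklore] -/
theorem not_tuning_of_eventually_zero_coupling (r : LatticeRep G) (sch : SpeciesScheme (YMSpecies G))
    {M : ℕ} {n : ℕ → ℕ} (hs : ∀ k, sch.a k = ((M : ℝ) ^ n k)⁻¹) (hβ : ∀ᶠ k in atTop, sch.β k = 0)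
    {θ : ℝ} (hθ : θ ≠ 0) :
    ¬ Tendsto (fun k => ((M : ℝ) ^ n k) ^ 8 *
        latticeConnectedCorr r.ρ (sch.β k) (sch.side k) r.curvature.F r.curvature.F (M ^ n k))
        atTop (𝓝 θ) := by
  intro ht
  have h0 : Tendsto (fun k => ((M : ℝ) ^ n k) ^ 8 *
      latticeConnectedCorr r.ρ (sch.β k) (sch.side k) r.curvature.F r.curvature.F (M ^ n k))
      atTop (𝓝 0) := by
    refine tendsto_const_nhds.congr' ?_
    filter_upwards [hβ, curvatureCorr_zero_coupling_eventually r sch hs] with k hk hk0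
    rw [hk, hk0, mul_zero]
  exact hθ (tendsto_nhds_unique ht h0)

end ZeroCouplingTuning


section ZeroCouplingGap

variable {G : Type} [Group G] [TopologicalSpace G] [IsTopologicalGroup G] [CompactSpace G]
  [MeasurableSpace G] [BorelSpace G]

omit [Group G] [TopologicalSpace G] [IsTopologicalGroup G] [CompactSpace G] [MeasurableSpace G] [BorelSpace G] in
/-- General no-overlap lemma: if every edge of `SA` and `SB` has time coordinate in `[-R, R]`, then for separations
`2R < n` with `n + 2R < S` the torus projections of `SA` and of `SB + n e₀` are disjoint. [folklore] -/
theorem disjoint_torusSupports_of_time_bound (SA SB : Finset (Literature.MathematicalPhysics.QuantumLattice.ZdEdge 4))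
    (R : ℕ) (hA : ∀ e ∈ SA, |e.1 0| ≤ R) (hB : ∀ e ∈ SB, |e.1 0| ≤ R) {S n : ℕ} (hn : 2 * R < n)
    (hnS : n + 2 * R < S) :
    Disjoint (SA.image (torusEdge S))
      ((SB.image fun e : Literature.MathematicalPhysics.QuantumLattice.ZdEdge 4 =>
        (e.1 - -(Pi.single 0 (n : ℤ) : Literature.Probability.LatticeModels.Site 4), e.2)).image (torusEdge S)) := by
  rw [Finset.disjoint_left]
  rintro a ha hb
  rw [Finset.mem_image] at ha
  obtain ⟨e₁, he₁, rfl⟩ := ha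
  simp only [Finset.mem_image] at hb
  obtain ⟨e₂', ⟨e₂, he₂, rfl⟩, heq⟩ := hb
  have h1 := abs_le.1 (hA e₁ he₁)
  have h2 := abs_le.1 (hB e₂ he₂)
  have h0 : (((e₂.1 0 + (n : ℤ) : ℤ)) : ZMod S) = ((e₁.1 0 : ℤ) : ZMod S) := by
    have := congrArg (fun E : Edge 4 S => E.1 0) heq
    simpa [torusEdge, Literature.Probability.LatticeModels.Torus.proj] using this
  rw [ZMod.intCast_eq_intCast_iff_dvd_sub] at h0
  have hdvd : (S : ℤ) ∣ (e₂.1 0 + n) - e₁.1 0 := dvd_sub_comm.1 h0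
  have hpos : (0 : ℤ) < (e₂.1 0 + n) - e₁.1 0 := by omega
  have hle := Int.le_of_dvd hpos hdvd
  omega

/-- At zero coupling every lattice expectation of a product of two bounded observables is bounded by the product of
the bounds (probability measure). [folklore] -/
theorem abs_integral_mul_le_zero_coupling {N : ℕ} (ρ : G →* Matrix (Fin N) (Fin N) ℂ) (S : ℕ) [NeZero S]
    {f g : GaugeConfig 4 S G → ℝ} {Cf Cg : ℝ} (hf : ∀ U, |f U| ≤ Cf) (hg : ∀ U, |g U| ≤ Cg) :
    |∫ U, f U * g U ∂(wilsonMeasure (d := 4) (L := S) ρ 0)| ≤ Cf * Cg := by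
  rw [wilsonMeasure_zero_coupling ρ S]
  have h : ∀ U : GaugeConfig 4 S G, ‖f U * g U‖ ≤ Cf * Cg := fun U => by
    rw [Real.norm_eq_abs, abs_mul]
    exact mul_le_mul (hf U) (hg U) (abs_nonneg _) ((abs_nonneg _).trans (hf U))
  have := norm_integral_le_of_norm_le_const (μ := Measure.pi fun _ : Edge 4 S => haarProbability G)
    (Eventually.of_forall h)
  simpa using this

/-- **The lattice half holds with EVERY rate at zero coupling.** For a scheme with `β_k = 0` for all `k`, the
uniform lattice mass gap `HasLatticeMassGap r sch Δ` holds for every `Δ` (infinite gap: beyond the time-extent of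
the supports the connected correlations vanish identically, below it they are bounded). So the lattice half of
(B)'s conclusion does not detect triviality — which is why the summit statement carries `IsNontrivial` — and a
disprover cannot attack it through any ultralocal mechanism. (Tree docstring of `HasLatticeMassGap` asserts this
without proof; here it is a theorem.) [folklore] -/
theorem hasLatticeMassGap_of_zero_coupling {ι : Type} (r : LatticeRep G) (sch : SpeciesScheme ι)
    (hβ : ∀ k, sch.β k = 0) (Δ : ℝ) : HasLatticeMassGap r sch Δ := by
  intro A B
  obtain ⟨CA, hCA⟩ := A.bounded
  obtain ⟨CB, hCB⟩ := B.bounded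
  -- time extent of the two supports
  set R : ℕ := (A.supp ∪ B.supp).sup fun e => (e.1 0).natAbs with hR
  have hRA : ∀ e ∈ A.supp, |e.1 0| ≤ R := fun e he => by
    have : (e.1 0).natAbs ≤ R := Finset.le_sup (f := fun e => (e.1 0).natAbs) (Finset.mem_union_left _ he)
    rw [Int.abs_eq_natAbs]; exact_mod_cast this
  have hRB : ∀ e ∈ B.supp, |e.1 0| ≤ R := fun e he => by
    have : (e.1 0).natAbs ≤ R := Finset.le_sup (f := fun e => (e.1 0).natAbs) (Finset.mem_union_right _ he)
    rw [Int.abs_eq_natAbs]; exact_mod_cast this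
  refine ⟨2 * (CA * CB) * Real.exp (|Δ| * (2 * R)), ?_⟩
  have ha1 : ∀ᶠ k in atTop, sch.a k ≤ 1 :=
    (sch.tendsto_a.eventually (gt_mem_nhds one_pos)).mono fun k hk => hk.le
  have hL : ∀ᶠ k in atTop, (2 * R + 1 : ℝ) ≤ sch.a k * sch.L k := sch.tendsto_L.eventually_ge_atTop _
  filter_upwards [ha1, hL] with k hk1 hkL S hS n hn
  have hCAB : 0 ≤ CA * CB := mul_nonneg ((abs_nonneg _).trans (hCA 1)) ((abs_nonneg _).trans (hCB 1))
  -- L_k ≥ 2R + 1 (as naturals)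
  have hLk : 2 * R + 1 ≤ sch.L k := by
    have h1 : (2 * R + 1 : ℝ) ≤ sch.L k := by
      refine hkL.trans ?_
      calc sch.a k * sch.L k ≤ 1 * sch.L k :=
            mul_le_mul_of_nonneg_right hk1 (Nat.cast_nonneg _)
        _ = sch.L k := one_mul _
    exact_mod_cast h1
  rw [hβ k]
  by_cases hsmall : n ≤ 2 * R
  · -- bounded regime: |corr| ≤ 2 CA CB ≤ C e^{-Δ a n}
    have hcorr : |latticeConnectedCorr r.ρ 0 (2 * S + 1) A.F B.F n| ≤ 2 * (CA * CB) := by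
      unfold latticeConnectedCorr
      refine (abs_sub _ _).trans ?_
      have h1 := abs_integral_mul_le_zero_coupling r.ρ (2 * S + 1)
        (f := fun U => A.F (torusLift (2 * S + 1) U))
        (g := fun U => B.F (configShift (-Pi.single 0 (n : ℤ)) (torusLift (2 * S + 1) U)))
        (fun U => hCA _) (fun U => hCB _)
      have h2 : |(∫ U, A.F (torusLift (2 * S + 1) U) ∂(wilsonMeasure (d := 4) (L := 2 * S + 1) r.ρ 0)) *
          ∫ U, B.F (torusLift (2 * S + 1) U) ∂(wilsonMeasure (d := 4) (L := 2 * S + 1) r.ρ 0)| ≤ CA * CB := by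
        rw [abs_mul]
        have hA1 := abs_integral_mul_le_zero_coupling r.ρ (2 * S + 1)
          (f := fun U => A.F (torusLift (2 * S + 1) U)) (g := fun _ => (1 : ℝ)) (Cg := 1)
          (fun U => hCA _) (fun U => by simp)
        have hB1 := abs_integral_mul_le_zero_coupling r.ρ (2 * S + 1)
          (f := fun U => B.F (torusLift (2 * S + 1) U)) (g := fun _ => (1 : ℝ)) (Cg := 1)
          (fun U => hCB _) (fun U => by simp)
        simp only [mul_one] at hA1 hB1
        exact mul_le_mul hA1 hB1 (abs_nonneg _) ((abs_nonneg _).trans hA1)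
      linarith
    refine hcorr.trans ?_
    have hexp : Real.exp (-(|Δ| * (2 * R))) ≤ Real.exp (-(Δ * (sch.a k * n))) := by
      apply Real.exp_le_exp.2
      have hn' : (n : ℝ) ≤ 2 * R := by exact_mod_cast hsmall
      have han : 0 ≤ sch.a k * n := mul_nonneg (sch.a_pos k).le (Nat.cast_nonneg _)
      have : Δ * (sch.a k * n) ≤ |Δ| * (2 * R) := by
        calc Δ * (sch.a k * n) ≤ |Δ| * (sch.a k * n) := mul_le_mul_of_nonneg_right (le_abs_self Δ) han
          _ ≤ |Δ| * (1 * (2 * R)) := by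
              apply mul_le_mul_of_nonneg_left _ (abs_nonneg Δ)
              exact mul_le_mul hk1 hn' (Nat.cast_nonneg _) zero_le_one
          _ = |Δ| * (2 * R) := by ring
      linarith
    calc 2 * (CA * CB) = 2 * (CA * CB) * Real.exp (|Δ| * (2 * R)) * Real.exp (-(|Δ| * (2 * R))) := by
          rw [mul_assoc, ← Real.exp_add, add_neg_cancel, Real.exp_zero, mul_one]
      _ ≤ 2 * (CA * CB) * Real.exp (|Δ| * (2 * R)) * Real.exp (-(Δ * (sch.a k * n))) :=
          mul_le_mul_of_nonneg_left hexp (by positivity)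
  · -- ultralocal regime: the correlation vanishes identically
    push Not at hsmall
    have hzero : latticeConnectedCorr r.ρ 0 (2 * S + 1) A.F B.F n = 0 :=
      latticeConnectedCorr_zero_coupling r.ρ (2 * S + 1) A B n
        (disjoint_torusSupports_of_time_bound A.supp B.supp R hRA hRB hsmall (by omega))
    rw [hzero, abs_zero]
    positivity

/-- **The gap clauses of the summit are junk-reachable.** For every gauge group with a lattice representation,
the degenerate scheme (`β ≡ 0`, `c = m = 0`) and the vacuum-only OS datum satisfy `IsYangMillsFor` together with
`T.HasMassGap Δ ∧ HasLatticeMassGap r sch Δ` for EVERY `Δ`: everything in `YangMills` except the clauses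
`IsNontrivial`/`IsNonGaussian` is reachable by junk. For the crux: the SHAPE of (B)'s conclusion carries no
content by itself — all of (B)'s strength sits in its hypotheses selecting interacting (tuned, `β_k → ∞`)
sequences, consistent with §3. [folklore] -/
theorem gap_clauses_junk_reachable (r : LatticeRep G) :
    ∃ (sch : SpeciesScheme (YMSpecies G)) (T : OSData (YMSpecies G) 4),
      IsYangMillsFor r sch T ∧ ∀ Δ : ℝ, T.HasMassGap Δ ∧ HasLatticeMassGap r sch Δ :=
  ⟨SpeciesScheme.zero _, OSData.vacuum _ 4, isYangMillsFor_vacuum r,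
    fun Δ => ⟨OSData.vacuum_hasMassGap Δ, hasLatticeMassGap_of_zero_coupling r _ (fun _ => rfl) Δ⟩⟩

end ZeroCouplingGap

/-! ## §5 Load-bearing hypotheses (definitions; kills documented on paper in the docstrings) -/

section Without

/-- (B) WITHOUT `β_k → ∞` = the rev-3 statement. PAPER KILL (the reason for rev 4): tune at a bulk first-order
transition at finite `β_t` (van Enter–Shlosman arXiv:cond-mat/0306362 Thm 2 for `SU(n)` in fat representations;
Bhanot–Creutz endpoint, doi:10.1103/physrevd.24.3212, reducible `r`): on the finite-volume rounding tail the
plaquette covariance `θ a_k⁸` is met at `β_k → β_t < ∞` while fast tori destroy any uniform lattice gap. NOT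
formalisable today (needs two-sided control of a first-order transition). `rev4_of_withoutBeta` records that rev 4
is weaker. [folklore] -/
def WithoutBeta : Prop :=
  ∀ (G : Type) [Group G] [TopologicalSpace G] [IsTopologicalGroup G] [CompactSpace G],
    IsCompactSimpleLieGroup G →
      letI : MeasurableSpace G := borel G
      haveI : BorelSpace G := ⟨rfl⟩
      ∀ (r : LatticeRep G) (M : ℕ) (θ : ℝ) (sch : SpeciesScheme (YMSpecies G)) (n : ℕ → ℕ),
        2 ≤ M → 0 < θ → (∀ k, sch.a k = ((M : ℝ) ^ n k)⁻¹) →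
          Tendsto (fun k => ((M : ℝ) ^ n k) ^ 8 *
            latticeConnectedCorr r.ρ (sch.β k) (sch.side k) r.curvature.F r.curvature.F (M ^ n k))
            atTop (𝓝 θ) → Concl r sch

/-- rev 3 ⇒ rev 4. [folklore] -/
theorem crux_of_withoutBeta (h : WithoutBeta) : LatticeGapOnTrajectory := by
  intro G _ _ _ _ hG r M θ sch n hM hθ hs _ ht
  exact h G hG r M θ sch n hM hθ hs ht

/-- (B) WITHOUT the tuning (and without `0 < θ`): every `M`-adic Wilson scheme with `β_k → ∞` is uniformly
gapped. PAPER KILL: let `β_k → ∞` so fast that `ξ(β_k) ≫ L_k ≫ a_k⁻¹`; at fixed `k` the infinite-volume theory at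
`β_k` has (conjecturally) lattice mass `1/ξ(β_k)`, i.e. physical mass `M^{n_k}/ξ(β_k) → 0`, so no `Δ > 0` works in
`HasLatticeMassGap` (whose `∀ S ≥ L_k` clause probes the infinite volume at fixed `k`). NOT formalisable (needs
`ξ(β) → ∞`, Chatterjee Pb 5.1, AND an upper bound on the mass). The tuning is what ties `β_k` to `a_k`
(dimensional transmutation). [folklore] -/
def WithoutTuning : Prop :=
  ∀ (G : Type) [Group G] [TopologicalSpace G] [IsTopologicalGroup G] [CompactSpace G],
    IsCompactSimpleLieGroup G →
      letI : MeasurableSpace G := borel G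
      haveI : BorelSpace G := ⟨rfl⟩
      ∀ (r : LatticeRep G) (M : ℕ) (sch : SpeciesScheme (YMSpecies G)) (n : ℕ → ℕ),
        2 ≤ M → (∀ k, sch.a k = ((M : ℝ) ^ n k)⁻¹) → Tendsto sch.β atTop atTop → Concl r sch

/-- WithoutTuning ⇒ (B). [folklore] -/
theorem crux_of_withoutTuning (h : WithoutTuning) : LatticeGapOnTrajectory := by
  intro G _ _ _ _ hG r M θ sch n hM _ hs hβ _
  exact h G hG r M sch n hM hs hβ

/-- (B) WITHOUT `IsCompactSimpleLieGroup` (any compact group with a faithful unitary representation). NOT killed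
even on paper: the rigorous gapless 4-d lattice gauge phase, `U(1)₄` Coulomb (Guth 1980; Fröhlich–Spencer 1982;
barrier `Literature.Barriers.QuantumFields.AbelianDeconfinementD4`, conjecture `AbelianMasslessPhaseD4` for the
Wilson action), sits at FIXED `β > β_c`; under `β_k → ∞` its raw tuning amplitude `D⁸⟨P;P⟩_D ≈ c β⁻²` tends to `0`
(spin waves), so `Hyps` fails with `θ > 0`. Junk groups fail too (`not_hyps_of_subsingleton`). The honest
load-bearing content of simplicity is "no abelian FACTOR": `SU(2) × U(1)` with `ρ = 2 ⊕ 1` decouples, tunes through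
`SU(2)` and is gapless through `U(1)` (gen-1 remark) — a physics counterexample to THIS def, not formalisable
(needs both (S) for `SU(2)` and `AbelianMasslessPhaseD4`). [folklore] -/
def WithoutSimple : Prop :=
  ∀ (G : Type) [Group G] [TopologicalSpace G] [IsTopologicalGroup G] [CompactSpace G],
      letI : MeasurableSpace G := borel G
      haveI : BorelSpace G := ⟨rfl⟩
      ∀ (r : LatticeRep G) (M : ℕ) (θ : ℝ) (sch : SpeciesScheme (YMSpecies G)) (n : ℕ → ℕ),
        Hyps r M θ sch n → Concl r sch

/-- WithoutSimple ⇒ (B). [folklore] -/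
theorem crux_of_withoutSimple (h : WithoutSimple) : LatticeGapOnTrajectory := by
  rw [crux_iff]
  intro G _ _ _ _ _ r M θ sch n hyp
  exact h G r M θ sch n hyp

/-- `WithoutSimple` restricted to a trivial gauge group HOLDS (vacuously): the junk direction is closed.
[folklore] -/
theorem withoutSimple_at_subsingleton (G : Type) [Group G] [TopologicalSpace G] [IsTopologicalGroup G]
    [CompactSpace G] [Subsingleton G] :
    letI : MeasurableSpace G := borel G
    haveI : BorelSpace G := ⟨rfl⟩
    ∀ (r : LatticeRep G) (M : ℕ) (θ : ℝ) (sch : SpeciesScheme (YMSpecies G)) (n : ℕ → ℕ),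
      Hyps r M θ sch n → Concl r sch := by
  letI : MeasurableSpace G := borel G
  haveI : BorelSpace G := ⟨rfl⟩
  intro r M θ sch n hyp
  exact (not_hyps_of_subsingleton r M θ sch n hyp).elim

/-- (B) WITHOUT `2 ≤ M` is EQUIVALENT to (B) (`two_le_of_shape`). [folklore] -/
def WithoutM : Prop :=
  ∀ (G : Type) [Group G] [TopologicalSpace G] [IsTopologicalGroup G] [CompactSpace G],
    IsCompactSimpleLieGroup G →
      letI : MeasurableSpace G := borel G
      haveI : BorelSpace G := ⟨rfl⟩
      ∀ (r : LatticeRep G) (M : ℕ) (θ : ℝ) (sch : SpeciesScheme (YMSpecies G)) (n : ℕ → ℕ),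
        0 < θ → (∀ k, sch.a k = ((M : ℝ) ^ n k)⁻¹) → Tendsto sch.β atTop atTop →
          Tendsto (fun k => ((M : ℝ) ^ n k) ^ 8 *
            latticeConnectedCorr r.ρ (sch.β k) (sch.side k) r.curvature.F r.curvature.F (M ^ n k))
            atTop (𝓝 θ) → Concl r sch

/-- `2 ≤ M` is decoration: (B) ⇔ WithoutM. [folklore] -/
theorem crux_iff_withoutM : LatticeGapOnTrajectory ↔ WithoutM := by
  constructor
  · intro h G _ _ _ _ hG r M θ sch n hθ hs hβ ht
    exact h G hG r M θ sch n (two_le_of_shape sch hs) hθ hs hβ ht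
  · intro h G _ _ _ _ hG r M θ sch n _ hθ hs hβ ht
    exact h G hG r M θ sch n hθ hs hβ ht

end Without

/-! ## §6 Strengthenings and regimes (paper analysis, for ideators)

* TWO BRANCHES. Let `Φ(u) := u⁸ · G(u)` be the dimensionless connected `tr F²` two-point function of the continuum
  theory at physical distance `u` (mass units). Asymptotic freedom gives `Φ(u) → 0` as `u → 0⁺` (like `g(u)⁴`, i.e.
  `1/log²`), the gap gives `Φ(u) → 0` as `u → ∞`; so every small `θ` is attained on a UV branch `u₁(θ) → 0` and an
  IR branch `u₂(θ) → ∞`, and a tuned lattice sequence may sit on either (or alternate). (B) is insensitive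
  (`Δ = min`), but: a `θ`-UNIFORM rate is false (UV branch), and the unit physical scale of the crux is NOT forced to
  be perturbative or non-perturbative by `θ` alone.
* AMPLITUDE `β⁻²`. Wherever an expansion controls the plaquette two-point function — strong coupling (`β` small,
  Osterwalder–Seiler), finite volume at `β → ∞` (spin waves + torons), `U(1)` Coulomb phase — the dimensionless
  amplitude `D⁸⟨P ; τ_D P⟩` carries `β⁻²` (raw plaquette `P = Re tr U_p ≈ N − a⁴ g² tr F²/2 + …`, `g² ∝ 1/β`) and
  tends to `0` under `β_k → ∞`: tuned sequences exist only where `D_k ≍ ξ(β_k)` with a genuinely non-perturbative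
  `O(1)` amplitude — dimensional transmutation. This is why NO exactly solvable regime meets `Hyps` (§4, §4b).
* FINITE-β PARASITES (rev 3 → rev 4): bulk first-order transitions (fat representations, van Enter–Shlosman
  arXiv:cond-mat/0306362 Thm 2; large-`N` fundamental Wilson action, `N ≥ 5`, Lucini–Teper
  doi:10.1088/1126-6708/2001/06/050) and the Bhanot–Creutz critical endpoint (doi:10.1103/physrevd.24.3212) sit at
  finite `β`; the clause
  `Tendsto sch.β atTop atTop` removes them. No `β = ∞` parasite: `U_p = 1` is the unique maximiser of `Re tr r(U_p)`
  (faithful unitary `r`), mixed-action bulk lines are at finite `β`.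
* HETERODOXY. A Patrascioiu–Seiler-type massless weak-coupling phase for `SU(2)₄` (Patrascioiu PRL 54 (1985) 2292,
  doi:10.1103/physrevlett.54.2292; Patrascioiu–Seiler PRL 74 (1995) 1924, doi:10.1103/physrevlett.74.1924 — found
  via crossref 2026-08-15; searchd/OpenAlex/S2 degraded, page-level reading pending) would make the tuning amplitude
  vanish (free/conformal infrared), killing (S) and leaving (B) vacuous; it could refute (B) only if the infrared
  fixed point had a NON-ZERO dimension-8 amplitude `θ*` and then only at `θ = θ*` — no such scenario is on record.
* GROUPS. Trivial-centre groups (`G₂`, `F₄`, `E₈`) confine without centre symmetry and are believed gapped; `SO(3)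
  = PSU(2)` (adjoint Wilson action) has a finite-β bulk transition and twisted sectors on the torus, weak-coupling
  physics of `SU(2)`; none threatens (B).
-/

/-! ## §8 Targets (gen 3): the registered skeleton `Lines/dissipative-bridge.lean` (sha 4ba1ce0c…) and its 4 stubs

The `Cruxes/…/Lines` module is not importable (no olean on the farm), so the stub statements are COPIED verbatim
(whitespace-diffed against the skeleton) into the sub-namespace `DB`; every theorem below is about those copies and
transfers to the skeleton by `Iff.rfl`. Summary of findings — see the individual docstrings:
* stub 1 `UVPassage`: a THEOREM of the structure fields — `uvPassage_holds` (§8.4, sorry-free); its admissibility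
  block is TIGHT: `uvPassage_false_without_drift`, `uvPassage_false_without_absorption` (explicit junk charts at the
  trivial group, §8.3);
* stub 2 `BridgeChartExists`: carries the content, but its computer-assisted CERTIFICATE IS FORMALLY IDLE
  (`bridgeBody_of_rcc`, §8.1): body ⇐ chart + UV pin + running-coupling clustering, with `F = S.F`, `J = 0`;
  its body is junk-inhabited at the trivial group (`bridgeBody_of_subsingleton`, §8.2: the fields are jointly
  satisfiable); not cheaply refutable for simple `G` (its `transport` pin IS the AF-scaled infrared gap);
* stub 3 `ScaleAnchoring`: a THEOREM of `uv_bound` + the drift count — `scaleAnchoring_holds` (§8.4, sorry-free;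
  `w = w(θ)` through `g⋆ = min 1 (θ / 2Cuv)`);
* stub 4 `LatticeToTransfer`: not junk-refutable (`uniformLatticeGap_of_subsingleton` makes its hypothesis junk-true,
  and the conclusion then is a Schwartz-space density statement); morally true by positivity; no loophole found in
  the hypercubic-torus thermal terms (`e^{-Δ(P_k - t)} → 0` at fixed `t`) nor in `a_k L_k → ∞` arbitrarily slowly.
-/

namespace DB

open Literature.Probability.LatticeModels Literature.MathematicalPhysics.AQFT

/-! ### §8.0 Verbatim copies of the skeleton's definitions (the `Cruxes/…/Lines` module is not importable) -/

section Copies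

variable {X : Type} [NormedAddCommGroup X] [NormedSpace ℝ X]

/-- COPY of `DissipativeBridge.TrappingData` (skeleton sha 4ba1ce0c). [folklore] -/
def TrappingData (F : X → X) (P : X →L[ℝ] X) (N : ℕ → Set X) (ρ θ η : ℝ) (J : ℕ) : Prop :=
  (∀ x, P (P x) = P x) ∧ 0 ≤ ρ ∧ 0 ≤ θ ∧ θ < 1 ∧ 0 ≤ η ∧ η ≤ (1 - θ) * ρ ∧
  (∀ i, ∀ x ∈ N i, P x = x) ∧
  (∀ i < J, ∀ x ∈ N i, ∀ w : X, P w = 0 → ‖w‖ ≤ ρ →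
      ‖F (x + w) - P (F (x + w))‖ ≤ θ * ‖w‖ + η) ∧
  (∀ i < J, ∀ x ∈ N i, ∀ w : X, P w = 0 → ‖w‖ ≤ ρ → P (F (x + w)) ∈ N (i + 1))

end Copies

section ChartCopies

variable {G : Type} [Group G] [TopologicalSpace G] [IsTopologicalGroup G] [CompactSpace G]
  [MeasurableSpace G] [BorelSpace G] {r : LatticeRep G} {M : ℕ} (S : BalabanBanachStep G r M)

/-- COPY of `DissipativeBridge.InChart`. [folklore] -/
def InChart (p : ℝ × S.E) (j : ℕ) : Prop :=
  ∀ l ≤ j, (S.F^[l] p).1 ∈ Set.Icc 0 S.δ ∧ ‖(S.F^[l] p).2‖ ≤ S.R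

/-- COPY of `DissipativeBridge.tubeTop`. [folklore] -/
def tubeTop (γ : ℝ) : ℝ := γ + (S.b + S.C * (S.δ + S.R)) * γ ^ 3

/-- COPY of `DissipativeBridge.Tube`. [folklore] -/
def Tube (γ ρ : ℝ) : Set (ℝ × S.E) :=
  {p | γ ≤ p.1 ∧ p.1 ≤ tubeTop S γ ∧ ‖p.2‖ ≤ ρ}

/-- COPY of `DissipativeBridge.TubeAdmissible`. [folklore] -/
def TubeAdmissible (γ ρ : ℝ) : Prop :=
  0 < γ ∧ 0 < ρ ∧ ρ ≤ S.R ∧ tubeTop S γ ≤ S.δ ∧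
  2 * S.C * (tubeTop S γ) ^ 2 ≤ (1 - S.θ') * ρ ∧
  S.C * (tubeTop S γ + ρ) ≤ S.b / 2 ∧
  S.C * (tubeTop S γ + S.R) * (tubeTop S γ) ^ 2 ≤ 1 / 2

/-- COPY of `DissipativeBridge.le_tubeTop`. [folklore] -/
theorem le_tubeTop {γ : ℝ} (hγ : 0 ≤ γ) : γ ≤ tubeTop S γ := by
  unfold tubeTop
  have h1 : 0 ≤ S.b + S.C * (S.δ + S.R) := by
    have := S.b_pos; have := S.C_pos; have := S.δ_pos; have := S.R_pos
    positivity
  nlinarith [pow_nonneg hγ 3]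

/-- COPY of `DissipativeBridge.exists_tubeAdmissible`. [folklore] -/
theorem exists_tubeAdmissible {ε : ℝ} (hε : 0 < ε) :
    ∃ γ ρ : ℝ, γ ≤ ε ∧ TubeAdmissible S γ ρ := by
  have hθ' := S.θ'_lt_one
  have hC := S.C_pos
  have h1θ : 0 < 1 - S.θ' := by linarith
  set K : ℝ := 2 * S.C / (1 - S.θ') + 1 with hK
  have hKpos : 0 < K := by positivity
  have ht0 : Tendsto (fun γ : ℝ => tubeTop S γ) (𝓝 0) (𝓝 0) := by
    have hc : Continuous fun γ : ℝ => tubeTop S γ := by unfold tubeTop; fun_prop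
    simpa [tubeTop] using hc.tendsto 0
  have ht : Tendsto (fun γ : ℝ => tubeTop S γ) (𝓝[>] 0) (𝓝 0) :=
    tendsto_nhdsWithin_of_tendsto_nhds ht0
  have hρ : Tendsto (fun γ : ℝ => K * tubeTop S γ ^ 2) (𝓝[>] 0) (𝓝 0) := by
    simpa using (ht.pow 2).const_mul K
  have h3 : Tendsto (fun γ : ℝ => S.C * (tubeTop S γ + K * tubeTop S γ ^ 2)) (𝓝[>] 0) (𝓝 0) := by
    simpa using (ht.add hρ).const_mul S.C
  have h4 : Tendsto (fun γ : ℝ => S.C * (tubeTop S γ + S.R) * tubeTop S γ ^ 2) (𝓝[>] 0) (𝓝 0) := by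
    simpa using ((ht.add_const S.R).const_mul S.C).mul (ht.pow 2)
  have e0 : ∀ᶠ γ in 𝓝[>] (0 : ℝ), γ ∈ Set.Ioo 0 ε := Ioo_mem_nhdsGT hε
  have e1 : ∀ᶠ γ in 𝓝[>] (0 : ℝ), K * tubeTop S γ ^ 2 ≤ S.R :=
    hρ.eventually (eventually_le_nhds S.R_pos)
  have e2 : ∀ᶠ γ in 𝓝[>] (0 : ℝ), tubeTop S γ ≤ S.δ := ht.eventually (eventually_le_nhds S.δ_pos)
  have e3 : ∀ᶠ γ in 𝓝[>] (0 : ℝ), S.C * (tubeTop S γ + K * tubeTop S γ ^ 2) ≤ S.b / 2 :=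
    h3.eventually (eventually_le_nhds (by linarith [S.b_pos]))
  have e4 : ∀ᶠ γ in 𝓝[>] (0 : ℝ), S.C * (tubeTop S γ + S.R) * tubeTop S γ ^ 2 ≤ 1 / 2 :=
    h4.eventually (eventually_le_nhds (by norm_num))
  obtain ⟨γ, hγ0, hγ1, hγ2, hγ3, hγ4⟩ := (e0.and (e1.and (e2.and (e3.and e4)))).exists
  have hγpos : 0 < γ := hγ0.1
  have htop : 0 < tubeTop S γ := hγpos.trans_le (le_tubeTop S hγpos.le)
  refine ⟨γ, K * tubeTop S γ ^ 2, hγ0.2.le, hγpos, by positivity, hγ1, hγ2, ?_, hγ3, hγ4⟩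
  have hKid : (1 - S.θ') * K = 2 * S.C + (1 - S.θ') := by
    rw [hK]; field_simp
  have hsq : 0 ≤ tubeTop S γ ^ 2 := sq_nonneg _
  calc 2 * S.C * tubeTop S γ ^ 2 ≤ (2 * S.C + (1 - S.θ')) * tubeTop S γ ^ 2 := by nlinarith
    _ = (1 - S.θ') * (K * tubeTop S γ ^ 2) := by rw [← hKid]; ring

end ChartCopies

section StructureCopy

variable {G : Type} [Group G] [TopologicalSpace G] [IsTopologicalGroup G] [CompactSpace G]
  [MeasurableSpace G] [BorelSpace G] {r : LatticeRep G} {M' : ℕ}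

/-- COPY of `DissipativeBridge.BridgeChart` (the line's posited object; fields verbatim). [folklore] -/
structure BridgeChart (S : BalabanBanachStep G r M') where
  odd_M : Odd M'
  X : Type
  [instNormedAddCommGroup : NormedAddCommGroup X]
  [instNormedSpace : NormedSpace ℝ X]
  [instCompleteSpace : CompleteSpace X]
  F : X → X
  ι : ℝ × S.E → X
  ι_step : ∀ p : ℝ × S.E, p.1 ∈ Set.Icc 0 S.δ → ‖p.2‖ ≤ S.R → F (ι p) = ι (S.F p)
  H : Set X
  isOpen_H : IsOpen H
  κ : ℝ
  κ_pos : 0 < κ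
  c₁ : ℕ
  transport : ∀ A B : YMSpecies G, ∃ C : ℝ, ∀ g ∈ Set.Ioc 0 S.g₀, ∀ j : ℕ,
    InChart S (g, S.yW g) j →
    ∀ m : ℕ, F^[m] (ι (S.F^[j] (g, S.yW g))) ∈ H →
    ∀ T n : ℕ, c₁ * M' ^ (j + m) ≤ 2 * T + 1 → n ≤ T →
      |latticeConnectedCorr r.ρ (S.betaOf g) (2 * T + 1) A.F B.F n| ≤
        C * Real.exp (-(κ * n / (M' : ℝ) ^ (j + m)))
  Cuv : ℝ
  uv_bound : ∀ g ∈ Set.Ioc 0 S.g₀, ∀ i : ℕ, InChart S (g, S.yW g) i →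
    ∀ L D : ℕ, M' ^ i ≤ D → D < M' ^ (i + 1) → M' * D ≤ L →
      (D : ℝ) ^ 8 *
          |latticeConnectedCorr r.ρ (S.betaOf g) (2 * L + 1) r.curvature.F r.curvature.F D| ≤
        Cuv * ((S.F^[i] (g, S.yW g)).1) ^ 4

attribute [instance] BridgeChart.instNormedAddCommGroup BridgeChart.instNormedSpace
  BridgeChart.instCompleteSpace

/-- COPY of `DissipativeBridge.UniformLatticeGap`. [folklore] -/
def UniformLatticeGap {ι : Type} (r : LatticeRep G) (sch : SpeciesScheme ι) (Δ : ℝ) : Prop :=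
  ∃ k₀ : ℕ, ∀ A B : YMSpecies G, ∃ C : ℝ, ∀ k : ℕ, k₀ ≤ k → ∀ S : ℕ, sch.L k ≤ S →
    ∀ n : ℕ, n ≤ S →
      |latticeConnectedCorr r.ρ (sch.β k) (2 * S + 1) A.F B.F n| ≤
        C * Real.exp (-(Δ * (sch.a k * n)))

end StructureCopy

/-- COPY of stub statement 1 `DissipativeBridge.UVPassage`. [folklore] -/
def UVPassage : Prop :=
  ∀ (G : Type) [Group G] [TopologicalSpace G] [IsTopologicalGroup G] [CompactSpace G]
    [MeasurableSpace G] [BorelSpace G] (r : LatticeRep G) (M : ℕ) (S : BalabanBanachStep G r M)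
    (γ ρ : ℝ), TubeAdmissible S γ ρ →
    ∃ g₁ : ℝ, 0 < g₁ ∧ g₁ ≤ S.g₀ ∧ ∀ g ∈ Set.Ioc 0 g₁, ∃ j : ℕ,
      S.F^[j] (g, S.yW g) ∈ Tube S γ ρ ∧ InChart S (g, S.yW g) j ∧
      ∀ l < j, (S.F^[l] (g, S.yW g)).1 < γ

/-- The BODY of stub statement 2 at fixed `(G, r)` (everything after `IsCompactSimpleLieGroup G → ∀ r`).
[folklore] -/
def BridgeBody {G : Type} [Group G] [TopologicalSpace G] [IsTopologicalGroup G] [CompactSpace G]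
    [MeasurableSpace G] [BorelSpace G] (r : LatticeRep G) : Prop :=
  ∃ (M' : ℕ) (S : BalabanBanachStep G r M') (𝔛 : BridgeChart S)
    (γ ρ : ℝ), TubeAdmissible S γ ρ ∧
    ∃ (P : 𝔛.X →L[ℝ] 𝔛.X) (N : ℕ → Set 𝔛.X) (ρt θt ηt : ℝ) (J : ℕ),
      TrappingData 𝔛.F P N ρt θt ηt J ∧
      (∀ p ∈ Tube S γ ρ, P (𝔛.ι p) ∈ N 0 ∧ ‖𝔛.ι p - P (𝔛.ι p)‖ ≤ ρt) ∧
      (∀ z : 𝔛.X, P z ∈ N J → ‖z - P z‖ ≤ ρt → z ∈ 𝔛.H)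

/-- COPY of stub statement 2 `DissipativeBridge.BridgeChartExists`. [folklore] -/
def BridgeChartExists : Prop :=
  ∀ (G : Type) [Group G] [TopologicalSpace G] [IsTopologicalGroup G] [CompactSpace G],
    IsCompactSimpleLieGroup G →
    letI : MeasurableSpace G := borel G
    haveI : BorelSpace G := ⟨rfl⟩
    ∀ (r : LatticeRep G), ∃ (M' : ℕ) (S : BalabanBanachStep G r M') (𝔛 : BridgeChart S)
      (γ ρ : ℝ), TubeAdmissible S γ ρ ∧
      ∃ (P : 𝔛.X →L[ℝ] 𝔛.X) (N : ℕ → Set 𝔛.X) (ρt θt ηt : ℝ) (J : ℕ),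
        TrappingData 𝔛.F P N ρt θt ηt J ∧
        (∀ p ∈ Tube S γ ρ, P (𝔛.ι p) ∈ N 0 ∧ ‖𝔛.ι p - P (𝔛.ι p)‖ ≤ ρt) ∧
        (∀ z : 𝔛.X, P z ∈ N J → ‖z - P z‖ ≤ ρt → z ∈ 𝔛.H)

/-- `BridgeChartExists` is `∀ G simple, ∀ r, BridgeBody r` (definitional). [folklore] -/
theorem bridgeChartExists_iff :
    BridgeChartExists ↔
      ∀ (G : Type) [Group G] [TopologicalSpace G] [IsTopologicalGroup G] [CompactSpace G],
        IsCompactSimpleLieGroup G →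
        letI : MeasurableSpace G := borel G
        haveI : BorelSpace G := ⟨rfl⟩
        ∀ (r : LatticeRep G), BridgeBody r := Iff.rfl

/-- COPY of stub statement 3 `DissipativeBridge.ScaleAnchoring`. [folklore] -/
def ScaleAnchoring : Prop :=
  ∀ (G : Type) [Group G] [TopologicalSpace G] [IsTopologicalGroup G] [CompactSpace G]
    [MeasurableSpace G] [BorelSpace G] (r : LatticeRep G) (M' : ℕ) (S : BalabanBanachStep G r M')
    (𝔛 : BridgeChart S) (γ ρ : ℝ), TubeAdmissible S γ ρ → ∀ θ : ℝ, 0 < θ →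
    ∃ (w : ℕ) (g₁ : ℝ), 0 < g₁ ∧ g₁ ≤ S.g₀ ∧ ∀ g ∈ Set.Ioc 0 g₁, ∀ j : ℕ,
      InChart S (g, S.yW g) j → (∀ l ≤ j, (S.F^[l] (g, S.yW g)).1 ≤ tubeTop S γ) →
      ∀ i L D : ℕ, i + w ≤ j → M' ^ i ≤ D → D < M' ^ (i + 1) → M' * D ≤ L →
        (D : ℝ) ^ 8 *
            |latticeConnectedCorr r.ρ (S.betaOf g) (2 * L + 1) r.curvature.F r.curvature.F D| ≤
          θ / 2

/-- COPY of stub statement 4 `DissipativeBridge.LatticeToTransfer`. [folklore] -/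
def LatticeToTransfer : Prop :=
  ∀ (G : Type) [Group G] [TopologicalSpace G] [IsTopologicalGroup G] [CompactSpace G]
    [MeasurableSpace G] [BorelSpace G] (r : LatticeRep G) (sch : SpeciesScheme (YMSpecies G))
    (Δ : ℝ), 0 < Δ → Tendsto sch.β atTop atTop → UniformLatticeGap r sch Δ →
    ∀ sch' : SpeciesScheme (YMSpecies G), sch'.a = sch.a → sch'.β = sch.β → sch'.L = sch.L →
      ∀ T : OSData (YMSpecies G) 4, IsYangMillsFor r sch' T → T.HasMassGap Δ

/-! ### §8.1 The certificate of stub 2 is formally idle: `BridgeBody ⇐ chart + UV pin + IR clustering` -/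

section Idle

variable {G : Type} [Group G] [TopologicalSpace G] [IsTopologicalGroup G] [CompactSpace G]
  [MeasurableSpace G] [BorelSpace G] {r : LatticeRep G} {M' : ℕ}

/-- The UV output pin of the line, stated for the Bałaban chart `S` ITSELF (it never mentions the extension
`𝔛`): `D⁸ |⟨P ; τ_D P⟩_{β(g), 2L+1}| ≤ Cuv · g_i⁴` for `D ∈ [M'^i, M'^{i+1})`, `L ≥ M' D`, while the Wilson orbit is
in the chart. [folklore] -/
def UVBound (S : BalabanBanachStep G r M') (Cuv : ℝ) : Prop :=
  ∀ g ∈ Set.Ioc 0 S.g₀, ∀ i : ℕ, InChart S (g, S.yW g) i →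
    ∀ L D : ℕ, M' ^ i ≤ D → D < M' ^ (i + 1) → M' * D ≤ L →
      (D : ℝ) ^ 8 *
          |latticeConnectedCorr r.ρ (S.betaOf g) (2 * L + 1) r.curvature.F r.curvature.F D| ≤
        Cuv * ((S.F^[i] (g, S.yW g)).1) ^ 4

/-- **Running-coupling clustering** (the infrared lattice mass gap in asymptotic-scaling form, stated through
the chart `S` only): once the running coupling of a Wilson orbit exceeds `γ/2` after `j + m` block steps, the
FINE Wilson theory at `β(g)` clusters at lattice rate `κ / M'^{j+m}` on every torus of side `≥ c₁ M'^{j+m}`.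
The binding instance is the FIRST crossing of `γ/2` (it happens inside the chart, by the one-step bound
`remainder_basin`); later `m` only weaken the rate. [folklore] -/
def RunningCouplingClustering (S : BalabanBanachStep G r M') (γ κ : ℝ) (c₁ : ℕ) : Prop :=
  ∀ A B : YMSpecies G, ∃ C : ℝ, ∀ g ∈ Set.Ioc 0 S.g₀, ∀ j : ℕ, InChart S (g, S.yW g) j →
    ∀ m : ℕ, γ / 2 < (S.F^[m] (S.F^[j] (g, S.yW g))).1 →
    ∀ T n : ℕ, c₁ * M' ^ (j + m) ≤ 2 * T + 1 → n ≤ T →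
      |latticeConnectedCorr r.ρ (S.betaOf g) (2 * T + 1) A.F B.F n| ≤
        C * Real.exp (-(κ * n / (M' : ℝ) ^ (j + m)))

/-- **The junk bridge chart.** Over ANY Bałaban chart `S` with odd `M'`, the data `X = ℝ × E`, `F = S.F` (no
extension at all), `ι = id`, `H = {g > γ/2}` form a `BridgeChart S` as soon as the two output pins hold for `S`
itself (`UVBound`, `RunningCouplingClustering`). [folklore] -/
def junkChart (S : BalabanBanachStep G r M') (hodd : Odd M') {γ κ : ℝ} (hκ : 0 < κ) {c₁ : ℕ} {Cuv : ℝ}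
    (huv : UVBound S Cuv) (hrcc : RunningCouplingClustering S γ κ c₁) : BridgeChart S where
  odd_M := hodd
  X := ℝ × S.E
  F := S.F
  ι := id
  ι_step := fun _ _ _ => rfl
  H := {p | γ / 2 < p.1}
  isOpen_H := isOpen_lt continuous_const continuous_fst
  κ := κ
  κ_pos := hκ
  c₁ := c₁
  transport := hrcc
  Cuv := Cuv
  uv_bound := huv

/-- **Stub 2's certificate is idle.** Given a Bałaban chart with odd block factor, an admissible tube, the UV pin
and running-coupling clustering, the BODY of `BridgeChartExists` holds — with the junk chart, the identity as
Galerkin projection, all boxes equal to `H = {g > γ/2} ⊇ Tube`, zero tail radius and `J = 0` steps: no enclosure,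
no computation. Hence, AS TYPED, `stub_bridgeChart` is implied by (∃ chart with UV pin) ∧ (IR lattice gap beyond
the tube in running-coupling form); the Zgliczyński–Mischaikow certificate is a proof METHOD for the clustering
statement, not part of its logical content, and the line card's "why easier: finite-time, decidable by interval
arithmetic" is not a property of the typed `C⁺`. (Converse sandwich: the skeleton's `LatticeGapOnTrajectory_of`
derives AF-scaled clustering FROM the stub.) [folklore] -/
theorem bridgeBody_of_rcc (S : BalabanBanachStep G r M') (hodd : Odd M') {γ ρ κ : ℝ}
    (hadm : TubeAdmissible S γ ρ) (hκ : 0 < κ) {c₁ : ℕ} {Cuv : ℝ} (huv : UVBound S Cuv)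
    (hrcc : RunningCouplingClustering S γ κ c₁) : BridgeBody r := by
  refine ⟨M', S, junkChart S hodd hκ huv hrcc, γ, ρ, hadm, ContinuousLinearMap.id ℝ _,
    fun _ => {p : ℝ × S.E | γ / 2 < p.1}, 0, 0, 0, 0, ?_, ?_, ?_⟩
  · refine ⟨fun _ => rfl, le_rfl, le_rfl, zero_lt_one, le_rfl, by norm_num, fun _ _ _ => rfl,
      fun i hi => absurd hi (Nat.not_lt_zero i), fun i hi => absurd hi (Nat.not_lt_zero i)⟩
  · intro p hp
    refine ⟨?_, by simp⟩
    show γ / 2 < p.1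
    have hγ := hadm.1
    have hp1 : γ ≤ p.1 := hp.1
    linarith
  · intro z hz _
    exact hz

/-- The same, packaged as an implication between `∀ G r` statements: running-coupling clustering over some chart
(for every compact simple `G` and `r`) proves `BridgeChartExists`. [folklore] -/
theorem bridgeChartExists_of_rcc
    (h : ∀ (G : Type) [Group G] [TopologicalSpace G] [IsTopologicalGroup G] [CompactSpace G],
      IsCompactSimpleLieGroup G →
      letI : MeasurableSpace G := borel G
      haveI : BorelSpace G := ⟨rfl⟩
      ∀ (r : LatticeRep G), ∃ (M' : ℕ) (S : BalabanBanachStep G r M') (γ ρ κ Cuv : ℝ) (c₁ : ℕ),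
        Odd M' ∧ TubeAdmissible S γ ρ ∧ 0 < κ ∧ UVBound S Cuv ∧ RunningCouplingClustering S γ κ c₁) :
    BridgeChartExists := by
  intro G _ _ _ _ hG
  letI : MeasurableSpace G := borel G
  haveI : BorelSpace G := ⟨rfl⟩
  intro r
  obtain ⟨M', S, γ, ρ, κ, Cuv, c₁, hodd, hadm, hκ, huv, hrcc⟩ := h G hG r
  exact bridgeBody_of_rcc S hodd hadm hκ huv hrcc

end Idle

/-! ### §8.2 Junk audit of the hypothesis structures at the trivial gauge group -/

section TrivialGroup

variable {G : Type} [Group G] [TopologicalSpace G] [IsTopologicalGroup G] [CompactSpace G]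
  [MeasurableSpace G] [BorelSpace G]

/-- At the trivial group the torus Wilson mean of an observable is its (constant) value. [folklore] -/
theorem wilsonTorusMean_of_subsingleton [Subsingleton G] {N : ℕ} (ρ : G →* Matrix (Fin N) (Fin N) ℂ)
    (hρ : Continuous ρ) (β : ℝ) (L : ℕ) (O : LGConfig 4 G → ℝ) :
    wilsonTorusMean ρ β L O = O 1 := by
  haveI := isProbabilityMeasure_wilsonMeasure (d := 4) (L := 2 * L + 1) ρ hρ β
  unfold wilsonTorusMean
  have : (fun U : GaugeConfig 4 (2 * L + 1) G => O (torusLift (2 * L + 1) U)) = fun _ => O 1 :=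
    funext fun U => congrArg O (Subsingleton.elim _ _)
  rw [this, integral_const, smul_eq_mul, probReal_univ, one_mul]

/-- At the trivial group the centred unit-lattice Wilson `n`-point functions are `1` for `n = 0` and `0`
otherwise (every centred field vanishes identically). [folklore] -/
theorem wilsonCentredSchwinger_of_subsingleton [Subsingleton G] {N : ℕ} (ρ : G →* Matrix (Fin N) (Fin N) ℂ)
    (hρ : Continuous ρ) (β : ℝ) (L : ℕ) (c : YMSpecies G → ℝ) (n : ℕ) (σ : Fin n → YMSpecies G)
    (f : Fin n → SchwartzMap (EuclideanSpace ℝ (Fin 4)) ℝ) :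
    wilsonCentredSchwinger ρ β L c n σ f = if n = 0 then 1 else 0 := by
  haveI := isProbabilityMeasure_wilsonMeasure (d := 4) (L := 2 * L + 1) ρ hρ β
  rcases Nat.eq_zero_or_pos n with rfl | hn
  · rw [wilsonCentredSchwinger_zero, if_pos rfl, probReal_univ]
  · rw [if_neg hn.ne']
    unfold wilsonCentredSchwinger
    have hzero : ∀ U : GaugeConfig 4 (2 * L + 1) G,
        (∏ i, smearedLatticeField (σ i).F (box 4 L) 1 (c (σ i)) (wilsonTorusMean ρ β L (σ i).F) (f i)
          (torusLift (2 * L + 1) U)) = 0 := by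
      intro U
      refine Finset.prod_eq_zero (Finset.mem_univ (⟨0, hn⟩ : Fin n)) ?_
      unfold smearedLatticeField
      rw [wilsonTorusMean_of_subsingleton ρ hρ β L]
      have hs : ∑ x ∈ box 4 L, f ⟨0, hn⟩ ((1 : ℝ) • siteToE x) *
          ((σ ⟨0, hn⟩).F (configShift (-x) (torusLift (2 * L + 1) U)) - (σ ⟨0, hn⟩).F 1) = 0 := by
        refine Finset.sum_eq_zero fun x _ => ?_
        rw [congrArg (σ ⟨0, hn⟩).F (Subsingleton.elim (configShift (-x) (torusLift (2 * L + 1) U)) 1),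
          sub_self, mul_zero]
      rw [hs, mul_zero]
    simp only [hzero, integral_zero]

/-- The zero operator on `ℝ` applied to anything is `0`. [folklore] -/
theorem hzeroCLM (y : ℝ) : (0 : ℝ →L[ℝ] ℝ) y = 0 := rfl

/-- **The trivial-group junk chart.** For a subsingleton gauge group and ANY block factor `M ≥ 2`, the pure
parabolic normal form `φ g y = g + (log M) g³`, `Ψ ≡ 0` on `E = ℝ`, Wilson embedding `yW ≡ 0`, `β(g) = 1/g²`
and the constant realisation functional `expect ≡ [n = 0]` inhabit `BalabanBanachStep G r M`: all lattice
fields are centred constants, so (4a)–(4c) hold trivially. Consequence for the skeleton: the `∀ G`-stubs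
`UVPassage`, `ScaleAnchoring`, `LatticeToTransfer` quantify over a NON-EMPTY class of charts even before crux
stmt-9684 (`BalabanStepParabolic`) is inhabited, and their truth there is decided by pure dynamics / pure
Schwartz-space analysis. [folklore] -/
def trivialStep [Subsingleton G] (r : LatticeRep G) {M : ℕ} (hM : 2 ≤ M) : BalabanBanachStep G r M where
  E := ℝ
  φ := fun g _ => g + Real.log M * g ^ 3
  Ψ := fun _ _ => 0
  A := 0
  b := Real.log M
  θ := 0
  C := 1
  δ := 1
  b_pos := Real.log_pos (by exact_mod_cast hM)
  θ_nonneg := le_rfl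
  θ_lt_one := zero_lt_one
  C_pos := zero_lt_one
  δ_pos := zero_lt_one
  norm_A_le := by simp
  remainder := fun g y _ _ => by
    constructor
    · simp only [sub_self, abs_zero]; positivity
    · simp only [hzeroCLM, sub_self, norm_zero]; positivity
  lipschitz_fibre := fun g y y' _ _ _ => by
    constructor
    · simp only [sub_self, abs_zero]; positivity
    · simp only [hzeroCLM, sub_self, norm_zero]; positivity
  lipschitz_base := fun g g' y _ _ _ => by
    constructor
    · have : g + Real.log M * g ^ 3 - (g' + Real.log M * g' ^ 3) - (g - g') -
          Real.log M * (g ^ 3 - g' ^ 3) = 0 := by ring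
      rw [this, abs_zero]; positivity
    · simp only [sub_self, norm_zero]; positivity
  b₀ := 1
  b_eq := (one_mul _).symm
  R := 1
  δ_le_R := le_rfl
  θ' := 0
  θ'_nonneg := le_rfl
  θ'_lt_one := zero_lt_one
  contraction := fun _ _ _ _ _ _ => by simp
  remainder_basin := fun g y _ _ => by simp only [sub_self, abs_zero]; positivity
  yW := fun _ => 0
  g₀ := 1
  g₀_pos := zero_lt_one
  continuousOn_yW := continuousOn_const
  norm_yW_le := fun _ _ => by simp
  betaOf := fun g => 1 / g ^ 2
  strictAntiOn_betaOf := fun a ha b hb hab =>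
    one_div_lt_one_div_of_lt (pow_pos ha.1 2) (by nlinarith [ha.1, hb.1])
  continuousOn_betaOf :=
    continuousOn_const.div (continuousOn_pow 2) fun x hx => (pow_pos hx.1 2).ne'
  κ := 1
  κ_pos := zero_lt_one
  K := 0
  betaOf_sub_le := fun g _ => by simp
  c := fun _ _ => 1
  c_curvature := fun _ => rfl
  expect := fun _ _ n _ _ => if n = 0 then 1 else 0
  expect_step := fun _ _ _ _ _ _ _ _ => rfl
  expect_wilson := fun g _ L n σ f => (wilsonCentredSchwinger_of_subsingleton r.ρ r.continuous _ L _ n σ f).symm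
  continuousOn_expect := fun _ _ _ _ _ => continuousOn_const

/-- Non-vacuity of the hypothesis structure at the trivial group, every `M ≥ 2`. [folklore] -/
theorem nonempty_balabanBanachStep_of_subsingleton [Subsingleton G] (r : LatticeRep G) {M : ℕ} (hM : 2 ≤ M) :
    Nonempty (BalabanBanachStep G r M) :=
  ⟨trivialStep r hM⟩

/-- **Stub 2's body is junk-inhabited at the trivial group** (`M' = 3`, the trivial chart, any admissible tube,
junk bridge chart with both pins true because every correlation vanishes): the fields of `BridgeChart` + the
certificate + the tube conditions are JOINTLY SATISFIABLE (no hidden inconsistency in the posited object), and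
all the content of `BridgeChartExists` sits in the two output pins being about an interacting Wilson theory.
The hypothesis `IsCompactSimpleLieGroup G` of stub 2 is not what excludes this junk (junk makes the body TRUE);
it is there for `U(1)`-type groups, where the body is expected to be false. [folklore] -/
theorem bridgeBody_of_subsingleton [Subsingleton G] (r : LatticeRep G) : BridgeBody r := by
  have h3 : (2 : ℕ) ≤ 3 := by norm_num
  obtain ⟨γ, ρ, -, hadm⟩ := exists_tubeAdmissible (trivialStep r h3) one_pos
  refine bridgeBody_of_rcc (trivialStep r h3) (by decide) hadm one_pos (c₁ := 0) (Cuv := 0) ?_ ?_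
  · intro g _ i _ L D _ _ _
    rw [latticeConnectedCorr_eq_zero_of_subsingleton r.ρ, abs_zero, mul_zero, zero_mul]
  · intro A B
    refine ⟨0, fun g _ j _ m _ T n _ _ => ?_⟩
    rw [latticeConnectedCorr_eq_zero_of_subsingleton r.ρ, abs_zero, zero_mul]

/-- At the trivial group the hypothesis `UniformLatticeGap` of stub 4 holds for EVERY scheme and EVERY rate
(infinite uniform gap), so `LatticeToTransfer` restricted there asserts: every OS datum that is a continuum
limit of the (deterministic, multiplicative) lattice Schwinger functions of constant fields has every mass gap
`Δ > 0` — a pure Schwartz-space density statement (off-diagonal real product tensors are total among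
time-ordered append tensors), believed true; no junk refutation of stub 4 through the trivial group. [folklore] -/
theorem uniformLatticeGap_of_subsingleton [Subsingleton G] {ι : Type} (r : LatticeRep G) (sch : SpeciesScheme ι)
    (Δ : ℝ) : UniformLatticeGap r sch Δ := by
  refine ⟨0, fun A B => ⟨0, fun k _ S _ n _ => ?_⟩⟩
  rw [latticeConnectedCorr_eq_zero_of_subsingleton r.ρ, abs_zero, zero_mul]

/-! ### §8.3 Tightness of stub 1: the drift and absorption conditions of `TubeAdmissible` are load-bearing -/

/-- **A one-parameter family of junk charts at the trivial group** (`M = 2`, `E = ℝ`, `C = 3`, `δ = R = 1`,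
`θ = θ' = 0`, `yW ≡ 0`): coupling step `φ g y = g + g³ (b − y)` — the fibre coordinate FEEDS BACK into the drift
with the maximal strength the remainder bounds allow — and fibre step `Ψ g y = g²`. All axioms of
`BalabanBanachStep` hold (the realisation functional is the constant `[n = 0]`, lattice fields being centred
constants). Its dynamics `g' = g + g³(b − y)`, `y' = g²` has the circle of fixed points `g² = b`, attracting from
below: the running coupling STALLS at `√b`. [folklore] -/
abbrev junkStep [Subsingleton G] (r : LatticeRep G) (b : ℝ) (hb : 0 < b) : BalabanBanachStep G r 2 where
  E := ℝ
  φ := fun g y => g + g ^ 3 * (b - y)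
  Ψ := fun g _ => g ^ 2
  A := 0
  b := b
  θ := 0
  C := 3
  δ := 1
  b_pos := hb
  θ_nonneg := le_rfl
  θ_lt_one := zero_lt_one
  C_pos := by norm_num
  δ_pos := zero_lt_one
  norm_A_le := by simp
  remainder := fun g y _ _ => by
    constructor
    · have h1 : g + g ^ 3 * (b - y) - (g + b * g ^ 3) = -(g ^ 3 * y) := by ring
      rw [h1, abs_neg, abs_mul, abs_pow, Real.norm_eq_abs]
      have h4 : 0 ≤ g ^ 4 := by positivity
      have h5 : 0 ≤ |g| ^ 3 * |y| := by positivity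
      linarith
    · rw [hzeroCLM, sub_zero, Real.norm_eq_abs, abs_of_nonneg (sq_nonneg g), Real.norm_eq_abs, sq_abs]
      nlinarith [sq_nonneg g, sq_nonneg y]
  lipschitz_fibre := fun g y y' _ _ _ => by
    constructor
    · have h1 : g + g ^ 3 * (b - y) - (g + g ^ 3 * (b - y')) = -(g ^ 3 * (y - y')) := by ring
      rw [h1, abs_neg, abs_mul, abs_pow, Real.norm_eq_abs]
      nlinarith [mul_nonneg (pow_nonneg (abs_nonneg g) 3) (abs_nonneg (y - y'))]
    · rw [hzeroCLM, sub_self, sub_zero, norm_zero]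
      positivity
  lipschitz_base := fun g g' y _ _ _ => by
    constructor
    · set m : ℝ := max |g| |g'| with hm
      have hgm : |g| ≤ m := le_max_left _ _
      have hgm' : |g'| ≤ m := le_max_right _ _
      have hm0 : 0 ≤ m := (abs_nonneg g).trans hgm
      have h1 : g + g ^ 3 * (b - y) - (g' + g' ^ 3 * (b - y)) - (g - g') - b * (g ^ 3 - g' ^ 3) =
          -(y * (g ^ 3 - g' ^ 3)) := by ring
      have h3 : |g ^ 3 - g' ^ 3| ≤ 3 * m ^ 2 * |g - g'| := by
        have h2 : g ^ 3 - g' ^ 3 = (g - g') * (g ^ 2 + g * g' + g' ^ 2) := by ring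
        rw [h2, abs_mul]
        have hq : |g ^ 2 + g * g' + g' ^ 2| ≤ 3 * m ^ 2 := by
          calc |g ^ 2 + g * g' + g' ^ 2| ≤ |g ^ 2| + |g * g'| + |g' ^ 2| := abs_add_three _ _ _
            _ = |g| ^ 2 + |g| * |g'| + |g'| ^ 2 := by rw [abs_pow, abs_mul, abs_pow]
            _ ≤ m ^ 2 + m * m + m ^ 2 := by gcongr
            _ = 3 * m ^ 2 := by ring
        calc |g - g'| * |g ^ 2 + g * g' + g' ^ 2| ≤ |g - g'| * (3 * m ^ 2) :=
              mul_le_mul_of_nonneg_left hq (abs_nonneg _)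
          _ = 3 * m ^ 2 * |g - g'| := by ring
      rw [h1, abs_neg, abs_mul, Real.norm_eq_abs]
      calc |y| * |g ^ 3 - g' ^ 3| ≤ |y| * (3 * m ^ 2 * |g - g'|) :=
            mul_le_mul_of_nonneg_left h3 (abs_nonneg y)
        _ ≤ 3 * m ^ 2 * (m + |y|) * |g - g'| := by
            nlinarith [mul_nonneg (mul_nonneg (sq_nonneg m) hm0) (abs_nonneg (g - g')), abs_nonneg y]
    · rw [Real.norm_eq_abs, show g ^ 2 - g' ^ 2 = (g + g') * (g - g') by ring, abs_mul]
      calc |g + g'| * |g - g'| ≤ (|g| + |g'|) * |g - g'| :=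
            mul_le_mul_of_nonneg_right (abs_add_le _ _) (abs_nonneg _)
        _ ≤ 3 * (|g| + |g'| + ‖y‖) * |g - g'| := by
            nlinarith [abs_nonneg g, abs_nonneg g', norm_nonneg y, abs_nonneg (g - g'),
              mul_nonneg (add_nonneg (add_nonneg (abs_nonneg g) (abs_nonneg g')) (norm_nonneg y))
                (abs_nonneg (g - g'))]
  b₀ := b / Real.log 2
  b_eq := (div_mul_cancel₀ b (Real.log_pos one_lt_two).ne').symm
  R := 1
  δ_le_R := le_rfl
  θ' := 0
  θ'_nonneg := le_rfl
  θ'_lt_one := zero_lt_one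
  contraction := fun _ _ _ _ _ _ => by simp
  remainder_basin := fun g y _ _ => by
    have h1 : g + g ^ 3 * (b - y) - (g + b * g ^ 3) = -(g ^ 3 * y) := by ring
    rw [h1, abs_neg, abs_mul, abs_pow, Real.norm_eq_abs]
    have h4 : 0 ≤ g ^ 4 := by positivity
    have h5 : 0 ≤ |g| ^ 3 * |y| := by positivity
    linarith
  yW := fun _ => 0
  g₀ := 1
  g₀_pos := zero_lt_one
  continuousOn_yW := continuousOn_const
  norm_yW_le := fun _ _ => by simp
  betaOf := fun g => 1 / g ^ 2
  strictAntiOn_betaOf := fun a ha b hb hab =>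
    one_div_lt_one_div_of_lt (pow_pos ha.1 2) (by nlinarith [ha.1, hb.1])
  continuousOn_betaOf :=
    continuousOn_const.div (continuousOn_pow 2) fun x hx => (pow_pos hx.1 2).ne'
  κ := 1
  κ_pos := zero_lt_one
  K := 0
  betaOf_sub_le := fun g _ => by simp
  c := fun _ _ => 1
  c_curvature := fun _ => rfl
  expect := fun _ _ n _ _ => if n = 0 then 1 else 0
  expect_step := fun _ _ _ _ _ _ _ _ => rfl
  expect_wilson := fun g _ L n σ f => (wilsonCentredSchwinger_of_subsingleton r.ρ r.continuous _ L _ n σ f).symm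
  continuousOn_expect := fun _ _ _ _ _ => continuousOn_const

section JunkDynamics

variable [Subsingleton G] (r : LatticeRep G) {b : ℝ} (hb : 0 < b)

/-- The junk step in coordinates. [folklore] -/
@[simp] theorem junkStep_F (g y : ℝ) :
    (junkStep r b hb).F (g, y) = (g + g ^ 3 * (b - y), g ^ 2) := rfl

/-- The Wilson embedding of the junk chart is `0`. [folklore] -/
@[simp] theorem junkStep_yW (g : ℝ) : (junkStep r b hb).yW g = 0 := rfl

/-- The fibre coordinate of every junk orbit started at a Wilson point is non-negative. [folklore] -/
theorem junk_snd_nonneg (g : ℝ) : ∀ l : ℕ, 0 ≤ ((junkStep r b hb).F^[l] (g, 0)).2 := by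
  intro l
  induction l with
  | zero => simp
  | succ l ih =>
    rw [Function.iterate_succ_apply']
    set p := (junkStep r b hb).F^[l] (g, 0)
    change 0 ≤ ((junkStep r b hb).F (p.1, p.2)).2
    rw [junkStep_F]
    exact sq_nonneg _

end JunkDynamics

section DriftTight

variable {G' : Type} -- (unused marker to keep section structure readable)

/-- `TubeAdmissible` with the DRIFT condition `C (γ⁺ + ρ) ≤ b/2` dropped. [folklore] -/
def TubeAdmissibleNoDrift {r : LatticeRep G} {M : ℕ} (S : BalabanBanachStep G r M) (γ ρ : ℝ) : Prop :=
  0 < γ ∧ 0 < ρ ∧ ρ ≤ S.R ∧ tubeTop S γ ≤ S.δ ∧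
  2 * S.C * (tubeTop S γ) ^ 2 ≤ (1 - S.θ') * ρ ∧
  S.C * (tubeTop S γ + S.R) * (tubeTop S γ) ^ 2 ≤ 1 / 2

/-- `TubeAdmissible` with the ABSORPTION condition `2 C γ⁺² ≤ (1 − θ') ρ` dropped. [folklore] -/
def TubeAdmissibleNoAbsorption {r : LatticeRep G} {M : ℕ} (S : BalabanBanachStep G r M) (γ ρ : ℝ) : Prop :=
  0 < γ ∧ 0 < ρ ∧ ρ ≤ S.R ∧ tubeTop S γ ≤ S.δ ∧
  S.C * (tubeTop S γ + ρ) ≤ S.b / 2 ∧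
  S.C * (tubeTop S γ + S.R) * (tubeTop S γ) ^ 2 ≤ 1 / 2

end DriftTight

/-- Stub 1 with the drift condition dropped from admissibility. [folklore] -/
def UVPassageWithoutDrift : Prop :=
  ∀ (G : Type) [Group G] [TopologicalSpace G] [IsTopologicalGroup G] [CompactSpace G]
    [MeasurableSpace G] [BorelSpace G] (r : LatticeRep G) (M : ℕ) (S : BalabanBanachStep G r M)
    (γ ρ : ℝ), TubeAdmissibleNoDrift S γ ρ →
    ∃ g₁ : ℝ, 0 < g₁ ∧ g₁ ≤ S.g₀ ∧ ∀ g ∈ Set.Ioc 0 g₁, ∃ j : ℕ,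
      S.F^[j] (g, S.yW g) ∈ Tube S γ ρ ∧ InChart S (g, S.yW g) j ∧
      ∀ l < j, (S.F^[l] (g, S.yW g)).1 < γ

/-- Stub 1 with the absorption condition dropped from admissibility. [folklore] -/
def UVPassageWithoutAbsorption : Prop :=
  ∀ (G : Type) [Group G] [TopologicalSpace G] [IsTopologicalGroup G] [CompactSpace G]
    [MeasurableSpace G] [BorelSpace G] (r : LatticeRep G) (M : ℕ) (S : BalabanBanachStep G r M)
    (γ ρ : ℝ), TubeAdmissibleNoAbsorption S γ ρ →
    ∃ g₁ : ℝ, 0 < g₁ ∧ g₁ ≤ S.g₀ ∧ ∀ g ∈ Set.Ioc 0 g₁, ∃ j : ℕ,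
      S.F^[j] (g, S.yW g) ∈ Tube S γ ρ ∧ InChart S (g, S.yW g) j ∧
      ∀ l < j, (S.F^[l] (g, S.yW g)).1 < γ

/-- The trivial lattice representation of the trivial group `Unit`. [folklore] -/
def unitRep : LatticeRep Unit where
  N := 1
  ρ := 1
  continuous := continuous_const
  injective := fun a b _ => Subsingleton.elim a b
  mem_unitary := fun _ => Submonoid.one_mem _

section Stall

/-- The stalling invariant of the junk dynamics at `b = 1/100`: `0 ≤ g ≤ 3/25`, `0 ≤ y ≤ 1`, and
`g ≥ 101/1000 ⇒ y ≥ 1/100` (the drift is then `≤ 0`). [folklore] -/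
def StallInv (p : ℝ × ℝ) : Prop :=
  0 ≤ p.1 ∧ p.1 ≤ 3 / 25 ∧ 0 ≤ p.2 ∧ p.2 ≤ 1 ∧ (101 / 1000 ≤ p.1 → 1 / 100 ≤ p.2)

/-- The stalling invariant is preserved by the junk step `g' = g + g³(1/100 − y)`, `y' = g²`. [folklore] -/
theorem stallInv_step {g y : ℝ} (h : StallInv (g, y)) :
    StallInv (g + g ^ 3 * (1 / 100 - y), g ^ 2) := by
  obtain ⟨hg0, hg1, hy0, hy1, himp⟩ := h
  simp only at hg0 hg1 hy0 hy1 himp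
  have hg3 : 0 ≤ g ^ 3 := by positivity
  have hg2 : g ^ 2 ≤ 9 / 625 := by nlinarith
  refine ⟨?_, ?_, ?_, ?_, ?_⟩
  · show 0 ≤ g + g ^ 3 * (1 / 100 - y)
    nlinarith [mul_nonneg hg3 (sub_nonneg.2 hy1), mul_le_mul_of_nonneg_left hg2 hg0]
  · show g + g ^ 3 * (1 / 100 - y) ≤ 3 / 25
    by_cases hc : 101 / 1000 ≤ g
    · have hy := himp hc
      have : g ^ 3 * (1 / 100 - y) ≤ 0 := mul_nonpos_of_nonneg_of_nonpos hg3 (by linarith)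
      linarith
    · push Not at hc
      have hp := pow_le_pow_left₀ hg0 hc.le 3
      nlinarith [mul_nonneg hg3 hy0]
  · show 0 ≤ g ^ 2
    exact sq_nonneg g
  · show g ^ 2 ≤ 1
    nlinarith
  · intro hc
    show 1 / 100 ≤ g ^ 2
    by_contra hlt
    push Not at hlt
    have hg10 : g < 1 / 10 := by
      by_contra h'
      push Not at h'
      nlinarith [mul_le_mul h' h' (by norm_num) hg0]
    have hp := pow_le_pow_left₀ hg0 hg10.le 3
    have : g + g ^ 3 * (1 / 100 - y) < 101 / 1000 := by nlinarith [mul_nonneg hg3 hy0]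
    exact absurd hc (not_le.2 this)

/-- Every junk orbit (`b = 1/100`) started at a Wilson point `g ≤ 1/20` satisfies the stalling invariant for
ever; in particular its coupling never exceeds `3/25` and both coordinates stay non-negative. [folklore] -/
theorem stallInv_orbit (r : LatticeRep Unit) {g : ℝ} (hg0 : 0 ≤ g) (hg1 : g ≤ 1 / 20) (l : ℕ) :
    StallInv ((junkStep r (1 / 100) (by norm_num)).F^[l] (g, 0)) := by
  induction l with
  | zero =>
    refine ⟨hg0, ?_, le_rfl, ?_, fun h => ?_⟩
    · show g ≤ 3 / 25
      linarith
    · show (0 : ℝ) ≤ 1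
      norm_num
    · change (101 / 1000 : ℝ) ≤ g at h
      linarith
  | succ l ih =>
    rw [Function.iterate_succ_apply']
    set p := (junkStep r (1 / 100) (by norm_num)).F^[l] (g, 0)
    change StallInv ((junkStep r (1 / 100) (by norm_num)).F (p.1, p.2))
    rw [junkStep_F]
    exact stallInv_step ih

/-- **The drift condition is load-bearing for stub 1.** Without `C (γ⁺ + ρ) ≤ b/2` in `TubeAdmissible`,
`UVPassage` is FALSE: in the junk chart `junkStep (b := 1/100)` at the trivial group the tube `γ = 1/5`,
`ρ = 1/2` satisfies every other admissibility condition, but every Wilson orbit started below `1/20` stalls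
under the attracting fixed circle `g = 1/10 < γ` (`stallInv_orbit`) and never enters the tube. So any proof of
`stub_uvPassage` must use the drift condition (it is what places all fixed points of the chart dynamics ABOVE
the tube). [folklore] -/
theorem uvPassage_false_without_drift : ¬ UVPassageWithoutDrift := by
  intro h
  have hadm : TubeAdmissibleNoDrift (junkStep unitRep (1 / 100) (by norm_num)) (1 / 5) (1 / 2) := by
    refine ⟨by norm_num, by norm_num, ?_, ?_, ?_, ?_⟩ <;> norm_num [tubeTop, junkStep]
  obtain ⟨g₁, hg₁, -, hpass⟩ :=
    h Unit unitRep 2 (junkStep unitRep (1 / 100) (by norm_num)) (1 / 5) (1 / 2) hadm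
  set g : ℝ := min g₁ (1 / 20) with hgdef
  have hg : g ∈ Set.Ioc 0 g₁ := ⟨lt_min hg₁ (by norm_num), min_le_left _ _⟩
  obtain ⟨j, hjT, -, -⟩ := hpass g hg
  have hinv := stallInv_orbit unitRep hg.1.le (min_le_right _ _) j
  have h1 : (1 / 5 : ℝ) ≤ ((junkStep unitRep (1 / 100) (by norm_num)).F^[j] (g, 0)).1 := hjT.1
  have h2 := hinv.2.1
  linarith

end Stall

section Thin

/-- **The absorption condition is load-bearing for stub 1.** Without `2 C γ⁺² ≤ (1 − θ') ρ`, `UVPassage` is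
FALSE: in the same junk chart `junkStep (b := 1/100)` the THIN tube `γ = 10⁻³`, `ρ = 10⁻⁷` satisfies every
other admissibility condition (drift included: `3 (γ⁺ + ρ) ≤ 1/200`); orbits started below `1/2000` are tame
(`stallInv_orbit`: `0 ≤ g`, `0 ≤ y`), and at any step `l + 1` with `g_{l+1} ≥ 10⁻³` the previous coupling was
`≥ 1/3000` (one step moves `g` by at most `g³/100`), so the fibre coordinate `y_{l+1} = g_l² > 10⁻⁷ = ρ`: the
orbit crosses the window `[γ, γ⁺]` OUTSIDE the thin tube (the fibre is not yet absorbed). So any proof of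
`stub_uvPassage` must use the absorption condition. [folklore] -/
theorem uvPassage_false_without_absorption : ¬ UVPassageWithoutAbsorption := by
  intro h
  have hadm : TubeAdmissibleNoAbsorption (junkStep unitRep (1 / 100) (by norm_num))
      (1 / 1000) (1 / 10000000) := by
    refine ⟨by norm_num, by norm_num, ?_, ?_, ?_, ?_⟩ <;> norm_num [tubeTop, junkStep]
  obtain ⟨g₁, hg₁, -, hpass⟩ :=
    h Unit unitRep 2 (junkStep unitRep (1 / 100) (by norm_num)) (1 / 1000) (1 / 10000000) hadm
  set g : ℝ := min g₁ (1 / 2000) with hgdef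
  have hg : g ∈ Set.Ioc 0 g₁ := ⟨lt_min hg₁ (by norm_num), min_le_left _ _⟩
  have hg2000 : g ≤ 1 / 2000 := min_le_right _ _
  obtain ⟨j, hjT, -, -⟩ := hpass g hg
  obtain ⟨hγ, -, hρ⟩ := hjT
  cases j with
  | zero =>
    change (1 / 1000 : ℝ) ≤ g at hγ
    linarith
  | succ l =>
    rw [Function.iterate_succ_apply'] at hγ hρ
    have hinv := stallInv_orbit unitRep hg.1.le (by linarith) l
    set p := (junkStep unitRep (1 / 100) (by norm_num)).F^[l] (g, 0) with hp
    obtain ⟨hp0, -, hy0, -, -⟩ := hinv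
    change (1 / 1000 : ℝ) ≤ ((junkStep unitRep (1 / 100) (by norm_num)).F (p.1, p.2)).1 at hγ
    change ‖((junkStep unitRep (1 / 100) (by norm_num)).F (p.1, p.2)).2‖ ≤ 1 / 10000000 at hρ
    rw [junkStep_F] at hγ hρ
    change (1 / 1000 : ℝ) ≤ p.1 + p.1 ^ 3 * (1 / 100 - p.2) at hγ
    change ‖p.1 ^ 2‖ ≤ (1 / 10000000 : ℝ) at hρ
    rw [Real.norm_eq_abs, abs_of_nonneg (sq_nonneg _)] at hρ
    have hsmall : p.1 ≤ 1 / 3000 := by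
      by_contra h'
      push Not at h'
      nlinarith [mul_le_mul h'.le h'.le (by norm_num) hp0]
    have hp3 := pow_le_pow_left₀ hp0 hsmall 3
    have hg3 : 0 ≤ p.1 ^ 3 := by positivity
    nlinarith [mul_nonneg hg3 hy0]

end Thin

end TrivialGroup

/-! ### §8.4 Stubs 1 and 3 are THEOREMS of the hypothesis structure (candidate proofs; a prover lands them)

`uvPassage_holds : UVPassage` and `scaleAnchoring_holds : ScaleAnchoring` below are sorry-free proofs of the verbatim
copies of the skeleton's stub statements 1 and 3 (axioms `propext`, `Classical.choice`, `Quot.sound`); pasted under the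
skeleton's namespace they close `stub_uvPassage` and `stub_anchoring` unchanged. For the adversary this settles that
neither stub can be refuted, and (with §8.3) that the admissibility block of stub 1 is exactly what its proof needs.
What remains of the line: stub 2 (= chart + UV pin + running-coupling clustering, §8.1) and stub 4 (positivity transfer).
-/

/-! ### One-step bounds below the tube top -/

section Steps

variable {G : Type} [Group G] [TopologicalSpace G] [IsTopologicalGroup G] [CompactSpace G]
  [MeasurableSpace G] [BorelSpace G] {r : LatticeRep G} {M : ℕ} (S : BalabanBanachStep G r M)
  {γ ρ : ℝ}

/-- The coupling at most halves in one step (positivity is kept): uses `C(γ⁺ + R)γ⁺² ≤ 1/2`. [folklore] -/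
theorem step_lower (hadm : TubeAdmissible S γ ρ) {g : ℝ} {y : S.E} (hg0 : 0 ≤ g) (hgp : g ≤ tubeTop S γ)
    (hy : ‖y‖ ≤ S.R) : g / 2 ≤ S.φ g y := by
  obtain ⟨-, -, -, htop, -, -, hhalf⟩ := hadm
  have hgδ : |g| ≤ S.δ := by rw [abs_of_nonneg hg0]; exact hgp.trans htop
  have hrem := S.remainder_basin g y hgδ hy
  rw [abs_of_nonneg hg0] at hrem
  have h1 := (abs_le.1 hrem).1
  have hC := S.C_pos.le
  have hb := S.b_pos.le
  have hR := S.R_pos.le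
  have hg3 : 0 ≤ g ^ 3 := by positivity
  have htp : 0 ≤ tubeTop S γ := hg0.trans hgp
  have key : S.C * (g ^ 4 + g ^ 3 * ‖y‖) ≤ g / 2 := by
    have hsq : g ^ 2 ≤ (tubeTop S γ) ^ 2 := pow_le_pow_left₀ hg0 hgp 2
    have hsum : g + S.R ≤ tubeTop S γ + S.R := by linarith
    calc S.C * (g ^ 4 + g ^ 3 * ‖y‖) ≤ S.C * (g ^ 4 + g ^ 3 * S.R) := by gcongr
      _ = g * (S.C * (g ^ 2 * (g + S.R))) := by ring
      _ ≤ g * (S.C * ((tubeTop S γ) ^ 2 * (tubeTop S γ + S.R))) := by gcongr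
      _ = g * (S.C * (tubeTop S γ + S.R) * (tubeTop S γ) ^ 2) := by ring
      _ ≤ g * (1 / 2) := by gcongr
      _ = g / 2 := by ring
  nlinarith [mul_nonneg hb hg3]

/-- One step moves the coupling up by at most `(b + C(δ + R)) g³`. [folklore] -/
theorem step_upper (hadm : TubeAdmissible S γ ρ) {g : ℝ} {y : S.E} (hg0 : 0 ≤ g) (hgp : g ≤ tubeTop S γ)
    (hy : ‖y‖ ≤ S.R) : S.φ g y ≤ g + (S.b + S.C * (S.δ + S.R)) * g ^ 3 := by
  obtain ⟨-, -, -, htop, -, -, -⟩ := hadm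
  have hgδ' : g ≤ S.δ := hgp.trans htop
  have hgδ : |g| ≤ S.δ := by rw [abs_of_nonneg hg0]; exact hgδ'
  have hrem := S.remainder_basin g y hgδ hy
  rw [abs_of_nonneg hg0] at hrem
  have h2 := (abs_le.1 hrem).2
  have hC := S.C_pos.le
  have hg3 : 0 ≤ g ^ 3 := by positivity
  have key : S.C * (g ^ 4 + g ^ 3 * ‖y‖) ≤ S.C * (S.δ + S.R) * g ^ 3 := by
    calc S.C * (g ^ 4 + g ^ 3 * ‖y‖) ≤ S.C * (g ^ 4 + g ^ 3 * S.R) := by gcongr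
      _ = S.C * (g + S.R) * g ^ 3 := by ring
      _ ≤ S.C * (S.δ + S.R) * g ^ 3 := by gcongr
  nlinarith

/-- Fibre step below the tube top: `‖Ψ g y‖ ≤ θ'‖y‖ + C γ⁺²`. [folklore] -/
theorem step_fibre (hadm : TubeAdmissible S γ ρ) {g : ℝ} {y : S.E} (hg0 : 0 ≤ g) (hgp : g ≤ tubeTop S γ)
    (hy : ‖y‖ ≤ S.R) : ‖S.Ψ g y‖ ≤ S.θ' * ‖y‖ + S.C * (tubeTop S γ) ^ 2 := by
  obtain ⟨-, -, -, htop, -, -, -⟩ := hadm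
  have hgδ : |g| ≤ S.δ := by rw [abs_of_nonneg hg0]; exact hgp.trans htop
  have h := S.norm_Ψ_le hgδ hy
  have hC := S.C_pos.le
  have hsq : g ^ 2 ≤ (tubeTop S γ) ^ 2 := pow_le_pow_left₀ hg0 hgp 2
  nlinarith [mul_le_mul_of_nonneg_left hsq hC]

/-- `C γ⁺² ≤ (1 − θ') ρ / 2` (half of the absorption conjunct). [folklore] -/
theorem C_sq_le (hadm : TubeAdmissible S γ ρ) : S.C * (tubeTop S γ) ^ 2 ≤ (1 - S.θ') * ρ / 2 := by
  obtain ⟨-, -, -, -, habs, -, -⟩ := hadm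
  linarith

/-- The basin `‖y‖ ≤ R` is kept below the tube top. [folklore] -/
theorem step_fibre_R (hadm : TubeAdmissible S γ ρ) {g : ℝ} {y : S.E} (hg0 : 0 ≤ g) (hgp : g ≤ tubeTop S γ)
    (hy : ‖y‖ ≤ S.R) : ‖S.Ψ g y‖ ≤ S.R := by
  have h := step_fibre S hadm hg0 hgp hy
  have h2 := C_sq_le S hadm
  obtain ⟨-, hρ, hρR, -, -, -, -⟩ := hadm
  have hθ0 := S.θ'_nonneg
  have hθ1 := S.θ'_lt_one
  nlinarith [mul_le_mul_of_nonneg_left hy hθ0]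

/-- Post-absorption drift: with `‖y‖ ≤ ρ`, `φ g y ≥ g + (b/2) g³` (uses `C(γ⁺ + ρ) ≤ b/2`). [folklore] -/
theorem step_drift (hadm : TubeAdmissible S γ ρ) {g : ℝ} {y : S.E} (hg0 : 0 ≤ g) (hgp : g ≤ tubeTop S γ)
    (hy : ‖y‖ ≤ ρ) : g + S.b / 2 * g ^ 3 ≤ S.φ g y := by
  obtain ⟨-, -, hρR, htop, -, hdrift, -⟩ := hadm
  have hyR : ‖y‖ ≤ S.R := hy.trans hρR
  have hgδ : |g| ≤ S.δ := by rw [abs_of_nonneg hg0]; exact hgp.trans htop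
  have hrem := S.remainder_basin g y hgδ hyR
  rw [abs_of_nonneg hg0] at hrem
  have h1 := (abs_le.1 hrem).1
  have hC := S.C_pos.le
  have hg3 : 0 ≤ g ^ 3 := by positivity
  have key : S.C * (g ^ 4 + g ^ 3 * ‖y‖) ≤ S.b / 2 * g ^ 3 := by
    calc S.C * (g ^ 4 + g ^ 3 * ‖y‖) ≤ S.C * (g ^ 4 + g ^ 3 * ρ) := by gcongr
      _ = S.C * (g + ρ) * g ^ 3 := by ring
      _ ≤ S.C * (tubeTop S γ + ρ) * g ^ 3 := by gcongr
      _ ≤ S.b / 2 * g ^ 3 := by gcongr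
  nlinarith

end Steps

/-- **Stub 1 of the skeleton `dissipative-bridge` holds**: Wilson orbits enter every admissible tube at their first
passage above `γ`, with in-chart history. [folklore] -/
theorem uvPassage_holds : UVPassage := by
  intro G _ _ _ _ _ _ r M S γ ρ hadm
  have hadm' := hadm
  obtain ⟨hγ, hρ, hρR, htop, habs, hdrift, hhalf⟩ := hadm'
  -- constants
  have hθ0 := S.θ'_nonneg
  have hθ1 := S.θ'_lt_one
  have hRpos := S.R_pos
  have hC := S.C_pos.le
  have hb := S.b_pos
  have hγp : γ ≤ tubeTop S γ := le_tubeTop S hγ.le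
  set c : ℝ := S.b + S.C * (S.δ + S.R) with hc
  have hcpos : 0 < c := by have := S.δ_pos; positivity
  set Kg : ℝ := 1 + c * (tubeTop S γ) ^ 2 with hKg
  have hKg1 : 1 ≤ Kg := by
    have : 0 ≤ c * (tubeTop S γ) ^ 2 := by positivity
    linarith
  have hKg0 : 0 < Kg := by linarith
  -- absorption time j₀ : θ'^{j₀} R ≤ ρ / 2
  obtain ⟨j₀, hj₀⟩ : ∃ j₀ : ℕ, S.θ' ^ j₀ * S.R ≤ ρ / 2 := by
    obtain ⟨n, hn⟩ := exists_pow_lt_of_lt_one (show 0 < ρ / (2 * S.R) by positivity) hθ1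
    refine ⟨n, ?_⟩
    have := (lt_div_iff₀ (by positivity : (0 : ℝ) < 2 * S.R)).1 hn
    linarith
  -- entrance coupling
  set g₁ : ℝ := min S.g₀ (γ / (2 * Kg ^ j₀)) with hg₁
  have hKpow : 0 < Kg ^ j₀ := by positivity
  have hg₁pos : 0 < g₁ := lt_min S.g₀_pos (by positivity)
  refine ⟨g₁, hg₁pos, min_le_left _ _, fun g hg => ?_⟩
  have hgpos : 0 < g := hg.1
  have hgg₀ : g ≤ S.g₀ := hg.2.trans (min_le_left _ _)
  have hgsmall : g * Kg ^ j₀ ≤ γ / 2 := by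
    have : g ≤ γ / (2 * Kg ^ j₀) := hg.2.trans (min_le_right _ _)
    rw [le_div_iff₀ (by positivity)] at this
    linarith
  have hgγ : g < γ := by
    have : g ≤ g * Kg ^ j₀ := le_mul_of_one_le_right hgpos.le (one_le_pow₀ hKg1)
    linarith
  -- the orbit
  set p : ℕ → ℝ × S.E := fun l => S.F^[l] (g, S.yW g) with hp
  have p0 : p 0 = (g, S.yW g) := rfl
  have psucc : ∀ l, p (l + 1) = S.F (p l) := fun l => Function.iterate_succ_apply' _ _ _
  have Ffst : ∀ q : ℝ × S.E, (S.F q).1 = S.φ q.1 q.2 := fun q => rfl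
  have Fsnd : ∀ q : ℝ × S.E, (S.F q).2 = S.Ψ q.1 q.2 := fun q => rfl
  -- one step from a state below γ
  have hstep : ∀ q : ℝ × S.E, 0 < q.1 → q.1 < γ → ‖q.2‖ ≤ S.R →
      0 < (S.F q).1 ∧ (S.F q).1 ≤ tubeTop S γ ∧ ‖(S.F q).2‖ ≤ S.R ∧ (S.F q).1 ≤ q.1 * Kg ∧
        ‖(S.F q).2‖ ≤ S.θ' * ‖q.2‖ + S.C * (tubeTop S γ) ^ 2 := by
    intro q hq0 hqγ hqy
    have hqp : q.1 ≤ tubeTop S γ := hqγ.le.trans hγp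
    rw [Ffst, Fsnd]
    have hlow := step_lower S hadm hq0.le hqp hqy
    have hup := step_upper S hadm hq0.le hqp hqy
    refine ⟨by linarith, ?_, step_fibre_R S hadm hq0.le hqp hqy, ?_, step_fibre S hadm hq0.le hqp hqy⟩
    · -- φ ≤ q.1 + c q.1³ ≤ γ + c γ³ = tubeTop
      have h3 : q.1 ^ 3 ≤ γ ^ 3 := pow_le_pow_left₀ hq0.le hqγ.le 3
      have : q.1 + c * q.1 ^ 3 ≤ γ + c * γ ^ 3 := add_le_add hqγ.le (mul_le_mul_of_nonneg_left h3 hcpos.le)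
      simpa [tubeTop, hc] using hup.trans this
    · -- φ ≤ q.1 (1 + c q.1²) ≤ q.1 Kg
      have hsq : q.1 ^ 2 ≤ (tubeTop S γ) ^ 2 := pow_le_pow_left₀ hq0.le hqp 2
      have : q.1 + c * q.1 ^ 3 ≤ q.1 * Kg := by
        rw [hKg]
        have : c * q.1 ^ 3 = q.1 * (c * q.1 ^ 2) := by ring
        nlinarith [mul_le_mul_of_nonneg_left (mul_le_mul_of_nonneg_left hsq hcpos.le) hq0.le]
      exact hup.trans this
  -- the orbit invariant while below γ
  have hInv : ∀ i : ℕ, (∀ i' < i, (p i').1 < γ) →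
      0 < (p i).1 ∧ (p i).1 ≤ tubeTop S γ ∧ ‖(p i).2‖ ≤ S.R ∧ (p i).1 ≤ g * Kg ^ i ∧
        ‖(p i).2‖ ≤ S.θ' ^ i * S.R + ρ / 2 := by
    intro i
    induction i with
    | zero =>
      intro _
      have hy0 : ‖S.yW g‖ ≤ S.R := S.norm_yW_le g ⟨hgpos.le, hgg₀⟩
      refine ⟨hgpos, hgγ.le.trans hγp, hy0, by simp [p0], ?_⟩
      show ‖S.yW g‖ ≤ S.θ' ^ 0 * S.R + ρ / 2
      rw [pow_zero, one_mul]; linarith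
    | succ i ih =>
      intro H
      have hi := ih fun i' hi' => H i' (Nat.lt_succ_of_lt hi')
      have hγi : (p i).1 < γ := H i (Nat.lt_succ_self i)
      obtain ⟨h0, -, hR, hgrow, hfib⟩ := hi
      obtain ⟨s0, sp, sR, sgrow, sfib⟩ := hstep (p i) h0 hγi hR
      rw [psucc]
      refine ⟨s0, sp, sR, ?_, ?_⟩
      · calc (S.F (p i)).1 ≤ (p i).1 * Kg := sgrow
          _ ≤ g * Kg ^ i * Kg := mul_le_mul_of_nonneg_right hgrow hKg0.le
          _ = g * Kg ^ (i + 1) := by ring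
      · have h2 := C_sq_le S hadm
        calc ‖(S.F (p i)).2‖ ≤ S.θ' * ‖(p i).2‖ + S.C * (tubeTop S γ) ^ 2 := sfib
          _ ≤ S.θ' * (S.θ' ^ i * S.R + ρ / 2) + (1 - S.θ') * ρ / 2 :=
              add_le_add (mul_le_mul_of_nonneg_left hfib hθ0) h2
          _ = S.θ' ^ (i + 1) * S.R + ρ / 2 := by ring
  -- below γ up to the absorption time
  have hBelow : ∀ i, i ≤ j₀ → ∀ i' ≤ i, (p i').1 < γ := by
    intro i
    induction i with
    | zero =>
      intro _ i' hi'
      rw [Nat.le_zero.1 hi', p0]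
      exact hgγ
    | succ i ih =>
      intro hij i' hi'
      rcases Nat.lt_or_ge i' (i + 1) with hlt | hge
      · exact ih (Nat.le_of_succ_le hij) i' (Nat.lt_succ_iff.1 hlt)
      · have heq : i' = i + 1 := le_antisymm hi' hge
        subst heq
        have hprev := ih (Nat.le_of_succ_le hij)
        obtain ⟨-, -, -, hgrow, -⟩ := hInv (i + 1) fun i' hi' => hprev i' (Nat.lt_succ_iff.1 hi')
        have hpow : Kg ^ (i + 1) ≤ Kg ^ j₀ := pow_le_pow_right₀ hKg1 hij
        have : g * Kg ^ (i + 1) ≤ g * Kg ^ j₀ := mul_le_mul_of_nonneg_left hpow hgpos.le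
        linarith
  -- passage happens
  have hPass : ∃ l, γ ≤ (p l).1 := by
    by_contra hno
    push Not at hno
    have hall : ∀ i, 0 < (p i).1 ∧ (p i).1 ≤ tubeTop S γ ∧ ‖(p i).2‖ ≤ S.R ∧ (p i).1 ≤ g * Kg ^ i ∧
        ‖(p i).2‖ ≤ S.θ' ^ i * S.R + ρ / 2 := fun i => hInv i fun i' _ => hno i'
    -- absorbed from j₀ on
    have habsorb : ∀ i, j₀ ≤ i → ‖(p i).2‖ ≤ ρ := by
      intro i hi
      have h := (hall i).2.2.2.2
      have hpow : S.θ' ^ i ≤ S.θ' ^ j₀ := pow_le_pow_of_le_one hθ0 hθ1.le hi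
      have : S.θ' ^ i * S.R ≤ S.θ' ^ j₀ * S.R := mul_le_mul_of_nonneg_right hpow hRpos.le
      linarith
    -- linear growth from j₀ on
    set u : ℝ := (p j₀).1 with hu
    have hu0 : 0 < u := (hall j₀).1
    set d : ℝ := S.b / 2 * u ^ 3 with hd
    have hdpos : 0 < d := by positivity
    have hlin : ∀ n : ℕ, u + n * d ≤ (p (j₀ + n)).1 := by
      intro n
      induction n with
      | zero => simp [hu]
      | succ n ih =>
        have hn0 : 0 < (p (j₀ + n)).1 := (hall (j₀ + n)).1
        have hnp : (p (j₀ + n)).1 ≤ tubeTop S γ := (hall (j₀ + n)).2.1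
        have hny : ‖(p (j₀ + n)).2‖ ≤ ρ := habsorb (j₀ + n) (Nat.le_add_right _ _)
        have hdr := step_drift S hadm hn0.le hnp hny
        have hge_u : u ≤ (p (j₀ + n)).1 := by
          have : (0 : ℝ) ≤ n * d := by positivity
          linarith
        have hcube : u ^ 3 ≤ (p (j₀ + n)).1 ^ 3 := pow_le_pow_left₀ hu0.le hge_u 3
        rw [show j₀ + (n + 1) = (j₀ + n) + 1 by ring, psucc, Ffst]
        have : S.b / 2 * u ^ 3 ≤ S.b / 2 * (p (j₀ + n)).1 ^ 3 :=
          mul_le_mul_of_nonneg_left hcube (by positivity)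
        push_cast
        nlinarith
    obtain ⟨n, hn⟩ := exists_nat_ge (γ / d)
    have hnd : γ ≤ n * d := by
      rw [div_le_iff₀ hdpos] at hn
      exact hn
    have := hlin n
    have := hno (j₀ + n)
    linarith
  -- the first passage
  classical
  let j := Nat.find hPass
  have hj : γ ≤ (p j).1 := Nat.find_spec hPass
  have hmin : ∀ l < j, (p l).1 < γ := fun l hl => not_le.1 (Nat.find_min hPass hl)
  have hj₀ : j₀ < j := by
    by_contra hle
    push Not at hle
    have := hBelow j hle j le_rfl
    linarith
  have hInvj := hInv j hmin
  refine ⟨j, ⟨hj, hInvj.2.1, ?_⟩, ?_, hmin⟩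
  · -- absorbed at the entrance step
    have h := hInvj.2.2.2.2
    have hpow : S.θ' ^ j ≤ S.θ' ^ j₀ := pow_le_pow_of_le_one hθ0 hθ1.le hj₀.le
    have : S.θ' ^ j * S.R ≤ S.θ' ^ j₀ * S.R := mul_le_mul_of_nonneg_right hpow hRpos.le
    linarith
  · -- in-chart history
    intro l hl
    have hInvl := hInv l fun i' hi' => hmin i' (lt_of_lt_of_le hi' hl)
    exact ⟨⟨hInvl.1.le, hInvl.2.1.trans htop⟩, hInvl.2.2.1⟩


/-- **Stub 3 of the skeleton `dissipative-bridge` holds**: the tuning anchors the landing scale. If `Cuv ≤ 0` the UV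
pin gives `0`; otherwise set `g⋆ = min 1 (θ / (2 Cuv))` (so `Cuv g⋆⁴ ≤ θ/2`), `u = g⋆ / 2^{j₀}` with
`θ'^{j₀} R ≤ ρ/2`, `d = (b/2) u³`, `w = j₀ + ⌈γ⁺/d⌉₊ + 1`: along an in-chart orbit with couplings `≤ γ⁺` up to step
`j`, if `Cuv g_i⁴ > θ/2` at some `i ≤ j − w` then `g_i > g⋆`, the coupling at most halves during the `j₀` absorption
steps and then climbs by `≥ d` per step, exceeding `γ⁺` at step `i + w ≤ j` — contradiction; so `Cuv g_i⁴ ≤ θ/2`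
and `uv_bound` concludes. [folklore] -/
theorem scaleAnchoring_holds : ScaleAnchoring := by
  intro G _ _ _ _ _ _ r M' S 𝔛 γ ρ hadm θ hθ
  have hadm' := hadm
  obtain ⟨hγ, hρ, hρR, htop, habs, hdrift, hhalf⟩ := hadm'
  have hθ0 := S.θ'_nonneg
  have hθ1 := S.θ'_lt_one
  have hRpos := S.R_pos
  have hb := S.b_pos
  have hγp : γ ≤ tubeTop S γ := le_tubeTop S hγ.le
  have hγp0 : 0 < tubeTop S γ := hγ.trans_le hγp
  -- trivial case: non-positive UV constant
  by_cases hCuv : 𝔛.Cuv ≤ 0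
  · refine ⟨0, S.g₀, S.g₀_pos, le_rfl, fun g hg j hchart _ i L D hij hD1 hD2 hL => ?_⟩
    have hci : InChart S (g, S.yW g) i := fun l hl => hchart l (hl.trans (by omega))
    have h := 𝔛.uv_bound g hg i hci L D hD1 hD2 hL
    have h4 : 0 ≤ ((S.F^[i] (g, S.yW g)).1) ^ 4 := by positivity
    have : 𝔛.Cuv * ((S.F^[i] (g, S.yW g)).1) ^ 4 ≤ 0 := mul_nonpos_of_nonpos_of_nonneg hCuv h4
    linarith
  push Not at hCuv
  -- the threshold coupling g⋆ with Cuv g⋆⁴ ≤ θ/2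
  set gs : ℝ := min 1 (θ / (2 * 𝔛.Cuv)) with hgs
  have hgs0 : 0 < gs := lt_min one_pos (by positivity)
  have hgs1 : gs ≤ 1 := min_le_left _ _
  have hgsθ : 𝔛.Cuv * gs ^ 4 ≤ θ / 2 := by
    have h1 : gs ^ 4 ≤ gs := by
      have : gs ^ 4 ≤ gs ^ 1 := pow_le_pow_of_le_one hgs0.le hgs1 (by norm_num)
      simpa using this
    have h2 : gs ≤ θ / (2 * 𝔛.Cuv) := min_le_right _ _
    calc 𝔛.Cuv * gs ^ 4 ≤ 𝔛.Cuv * (θ / (2 * 𝔛.Cuv)) :=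
          mul_le_mul_of_nonneg_left (h1.trans h2) hCuv.le
      _ = θ / 2 := by field_simp
  -- absorption time
  obtain ⟨j₀, hj₀⟩ : ∃ j₀ : ℕ, S.θ' ^ j₀ * S.R ≤ ρ / 2 := by
    obtain ⟨n, hn⟩ := exists_pow_lt_of_lt_one (show 0 < ρ / (2 * S.R) by positivity) hθ1
    refine ⟨n, ?_⟩
    have := (lt_div_iff₀ (by positivity : (0 : ℝ) < 2 * S.R)).1 hn
    linarith
  set u : ℝ := gs / 2 ^ j₀ with hu
  have hu0 : 0 < u := by positivity
  set d : ℝ := S.b / 2 * u ^ 3 with hd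
  have hd0 : 0 < d := by positivity
  set N : ℕ := ⌈tubeTop S γ / d⌉₊ with hN
  have hNd : tubeTop S γ ≤ N * d := by
    have h := Nat.le_ceil (tubeTop S γ / d)
    rw [div_le_iff₀ hd0] at h
    exact h
  refine ⟨j₀ + N + 1, S.g₀, S.g₀_pos, le_rfl, fun g hg j hchart htube i L D hij hD1 hD2 hL => ?_⟩
  -- the orbit
  set p : ℕ → ℝ × S.E := fun l => S.F^[l] (g, S.yW g) with hp
  have psucc : ∀ l, p (l + 1) = S.F (p l) := fun l => Function.iterate_succ_apply' _ _ _
  have Ffst : ∀ q : ℝ × S.E, (S.F q).1 = S.φ q.1 q.2 := fun q => rfl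
  have Fsnd : ∀ q : ℝ × S.E, (S.F q).2 = S.Ψ q.1 q.2 := fun q => rfl
  have hc0 : ∀ l ≤ j, 0 ≤ (p l).1 := fun l hl => (hchart l hl).1.1
  have hcR : ∀ l ≤ j, ‖(p l).2‖ ≤ S.R := fun l hl => (hchart l hl).2
  have hcp : ∀ l ≤ j, (p l).1 ≤ tubeTop S γ := fun l hl => htube l hl
  have hci : InChart S (g, S.yW g) i := fun l hl => hchart l (hl.trans (by omega))
  have hUV := 𝔛.uv_bound g hg i hci L D hD1 hD2 hL
  -- it suffices that Cuv g_i⁴ ≤ θ/2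
  suffices hsuff : 𝔛.Cuv * ((p i).1) ^ 4 ≤ θ / 2 from hUV.trans hsuff
  by_contra hbig
  push Not at hbig
  -- then g_i > g⋆
  have hgi : gs < (p i).1 := by
    by_contra hle
    push Not at hle
    have : (p i).1 ^ 4 ≤ gs ^ 4 := pow_le_pow_left₀ (hc0 i (by omega)) hle 4
    have : 𝔛.Cuv * (p i).1 ^ 4 ≤ 𝔛.Cuv * gs ^ 4 := mul_le_mul_of_nonneg_left this hCuv.le
    linarith
  -- (a) halving during absorption: g_{i+m} ≥ g⋆ / 2^m for m ≤ j₀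
  have H1 : ∀ m, m ≤ j₀ → gs / 2 ^ m ≤ (p (i + m)).1 := by
    intro m
    induction m with
    | zero => intro _; simpa using hgi.le
    | succ m ih =>
      intro hm
      have him : i + m ≤ j := by omega
      have hprev := ih (Nat.le_of_succ_le hm)
      have hlow := step_lower S hadm (hc0 _ him) (hcp _ him) (hcR _ him)
      rw [show i + (m + 1) = (i + m) + 1 by ring, psucc, Ffst]
      rw [pow_succ]
      have : gs / (2 ^ m * 2) = (gs / 2 ^ m) / 2 := by ring
      rw [this]
      linarith
  -- (b) fibre absorption along the segment
  have H2 : ∀ m, i + m ≤ j → ‖(p (i + m)).2‖ ≤ S.θ' ^ m * S.R + ρ / 2 := by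
    intro m
    induction m with
    | zero =>
      intro him
      have := hcR i (by simpa using him)
      simp only [add_zero, pow_zero, one_mul]
      linarith
    | succ m ih =>
      intro him
      have him' : i + m ≤ j := by omega
      have hprev := ih him'
      have hfib := step_fibre S hadm (hc0 _ him') (hcp _ him') (hcR _ him')
      have h2 := C_sq_le S hadm
      rw [show i + (m + 1) = (i + m) + 1 by ring, psucc, Fsnd]
      calc ‖S.Ψ (p (i + m)).1 (p (i + m)).2‖ ≤ S.θ' * ‖(p (i + m)).2‖ + S.C * (tubeTop S γ) ^ 2 := hfib
        _ ≤ S.θ' * (S.θ' ^ m * S.R + ρ / 2) + (1 - S.θ') * ρ / 2 :=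
            add_le_add (mul_le_mul_of_nonneg_left hprev hθ0) h2
        _ = S.θ' ^ (m + 1) * S.R + ρ / 2 := by ring
  have H3 : ∀ m, j₀ ≤ m → i + m ≤ j → ‖(p (i + m)).2‖ ≤ ρ := by
    intro m hm him
    have h := H2 m him
    have hpow : S.θ' ^ m ≤ S.θ' ^ j₀ := pow_le_pow_of_le_one hθ0 hθ1.le hm
    have : S.θ' ^ m * S.R ≤ S.θ' ^ j₀ * S.R := mul_le_mul_of_nonneg_right hpow hRpos.le
    linarith
  -- (c) linear climb after absorption
  have H4 : ∀ n : ℕ, i + (j₀ + n) ≤ j → u + n * d ≤ (p (i + (j₀ + n))).1 := by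
    intro n
    induction n with
    | zero =>
      intro _
      simpa [hu] using H1 j₀ le_rfl
    | succ n ih =>
      intro hidx
      have hidx' : i + (j₀ + n) ≤ j := by omega
      have hprev := ih hidx'
      have hx0 : 0 ≤ (p (i + (j₀ + n))).1 := hc0 _ hidx'
      have hxp := hcp _ hidx'
      have hxy : ‖(p (i + (j₀ + n))).2‖ ≤ ρ := H3 (j₀ + n) (Nat.le_add_right _ _) hidx'
      have hdr := step_drift S hadm hx0 hxp hxy
      have hge_u : u ≤ (p (i + (j₀ + n))).1 := by
        have : (0 : ℝ) ≤ n * d := by positivity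
        linarith
      have hcube : u ^ 3 ≤ (p (i + (j₀ + n))).1 ^ 3 := pow_le_pow_left₀ hu0.le hge_u 3
      have hmul : S.b / 2 * u ^ 3 ≤ S.b / 2 * (p (i + (j₀ + n))).1 ^ 3 :=
        mul_le_mul_of_nonneg_left hcube (by positivity)
      rw [show i + (j₀ + (n + 1)) = (i + (j₀ + n)) + 1 by ring, psucc, Ffst]
      push_cast
      nlinarith
  -- contradiction at step i + w ≤ j
  have hidx : i + (j₀ + (N + 1)) ≤ j := by omega
  have hclimb := H4 (N + 1) hidx
  have htop' := hcp _ hidx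
  push_cast at hclimb
  nlinarith

end DB

end

end Summit.QuantumFields.YangMills.Cruxes.LatticeGapOnTrajectory.Disproof
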